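import Mathlib
import Summits.ValiantsHypothesis.ValiantsHypothesis.Theorems.GrenetZeonDualUnipotentThreeHalvesFlagCostRunBound
import Summits.ValiantsHypothesis.ValiantsHypothesis.Theorems.GrenetZeonDualUnipotentThreeHalvesRadicalCoarseningFineFlag
import Summits.ValiantsHypothesis.ValiantsHypothesis.Theorems.GrenetZeonDualUnipotentThreeHalvesRadicalCoarsening
import Literature.LinearAlgebra.GMSPermanentalRankSubspace
import Literature.LinearAlgebra.GMSPermanentalRankSubspaceHolds
import Summits.ValiantsHypothesis.ValiantsHypothesis.Theses.GrenetZeon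
import Summits.ValiantsHypothesis.ValiantsHypothesis.Theorems.GrenetZeonDualUnipotentThreeHalvesPermRankOfLineFlat
import Summits.ValiantsHypothesis.ValiantsHypothesis.Theorems.GrenetZeonTwoDimCoefficientsDefs
import Summits.ValiantsHypothesis.ValiantsHypothesis.Theorems.GrenetZeonTwoDimCoefficientsDualUnipotentNormalForm
import Summits.ValiantsHypothesis.ValiantsHypothesis.Theorems.GrenetZeonTwoDimCoefficientsDualUnipotentTriangular
import Summits.ValiantsHypothesis.ValiantsHypothesis.Theorems.DualUnipotentThreeHalves.Negative.HeavyTopVacuousSmallM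
import Literature.LinearAlgebra.Matrix.GerstenhaberNilpotentSubspace
import Summits.ValiantsHypothesis.ValiantsHypothesis.Theorems.GrenetZeonDualUnipotentThreeHalvesHeavyTopThreeFour

/-!
# Line `radical_split` for the crux `GrenetZeon.DualUnipotentThreeHalves` (stmt-ValiantsHypothesis-24318)

val-idea-9 g3 (negation lens), LINE 3 of the lineage.  A TYPED SPLIT of the residual law S3b `FlagCostLaw`
of the line `flag_cost` (whose S3a `RunBound` is proved there and here) along the WEDDERBURN REDUCTION:

* **R1 — RADICAL COARSENING (per-agnostic THEOREM candidate, size L; stub `stub_radicalCoarsening`).**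
  Let `𝒜(N)` be the unital matrix algebra generated by the values `N(x)` of an affine pencil and let
  `K ≤ ℂ^{n×n}` be TRACE-ORTHOGONAL to it: `tr(N_lin(v)·b) = 0` for all `v ∈ K`, `b ∈ 𝒜(N)` — by the
  trace-form characterisation of the radical (`{a ∈ 𝒜 : tr(a𝒜) = 0} = rad 𝒜`, char 0) this says exactly
  `N_lin(K) ⊆ rad 𝒜(N)`, but it is stated as plain linear algebra.  CLAIM: `16·m·⌊√n⌋ + 16·n < dim K ⇒
  FlagCheap n m N`.  PAPER PROOF (card §2): the Loewy flag `G_t = (rad 𝒜)^t ℂ^m` is preserved by every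
  `N(x) ∈ 𝒜` (drop `r = 0`); group the fine layers greedily (a layer of dimension `> λ` alone, runs of
  thin layers merged up to total `≤ 2λ`, `λ = ⌊√n⌋`), `p ≤ 3m/λ + 1` groups; the coarse climbers
  `W = {v : N_lin(v) kills every coarse layer}` have `codim W ≤ (n² − dim K) + 4mλ + 2λ²` (the action on
  fine layers factors through `𝒱/(𝒱 ∩ rad)`, of dimension `≤ n² − dim K`; inside a merged run only the
  strictly-upper fine blocks remain, `≤ 2λ²` per run); with `k = p − 1` the budget `codim W + p·n < n²`
  follows from the hypothesis.  R1 EXTENDS val-neg-2's Lemma (D) / price P3 (simultaneously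
  triangularisable ⇒ `𝒱 ⊆ rad`, `K = ℂ^{n×n}`) to every LIGHT-TOP pencil, with a worse constant.
* **R2 — HEAVY-TOP LAW (the residual crux of this line; LAW tier; stub `stub_heavyTopLaw`).**  If
  `C₀m² < n³`, `N` affine nilpotent, and EVERY trace-orthogonal `K` has `dim K ≤ 16m⌊√n⌋ + 16n` (the
  coefficient space survives almost injectively in the semisimple top `𝒜/rad 𝒜 ≅ ⊕ M_{d_j}`, where by
  Burnside its components are IRREDUCIBLE nilpotent spaces), then `N` is flag-cheap.  This is where
  located-A points: `L_k` (`𝒜 = M_{3k}` simple, `rad = 0`) and `B(a,b)` are heavy-top and flag-cheap via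
  the one-level-return flag `p = 3, r = a = 1`; balanced non-triangularisable bipartite classes are the
  undecided row.  Why it might fail: an irreducible-top-heavy space at `dim ≈ m^{4/3}` expensive for every
  bounded-drop flag, or cancellation-only slowness.
GLUE (proved): `flagCostLaw_of_split : R1 → R2 → FlagCostLaw` (case split on the existence of a large
trace-orthogonal `K`), then the `flag_cost` chain: `RunBound` (PROVED, `runBound_proof`) and S1, S2 give
`dualUnipotentThreeHalves_of : S1 → S2 → R1 → R2 → GrenetZeon.DualUnipotentThreeHalves` BY NAME.

STUBS (registered targets): `stub_permRank_of_lineFlat` (S1, folklore, M), `stub_gms` (S2, GMS 2023 Cor 1.6,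
L), `stub_radicalCoarsening` (R1, per-agnostic theorem candidate, L), `stub_heavyTopLaw` (R2, LAW).

§0–§4 are a VERBATIM copy of `Lines/flag_cost.lean` (interface of `slow_planes` + flags + the proof of
S3a): Cruxes workfiles are not importable on the farm, and identical normalised signatures are the same
items.  SAME-WALL: everything here is per-agnostic except S1/S2, which hold verbatim for `det_n`; the line
is a restricted-model width-`n^{3/2}` bound for per AND det alike (VERDICT #14a P6).  VP ≠ VNP is not moved;
nothing here asserts 24318, 8062, S3, S3b, R1 or R2.

§6 (g3) = R2 DOSSIER bricks (trace isotropy, core rigidity).  §7 (g4, negation lens) = the WORD–FLAG DUALITY,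
kernel-checked and sorry-free: `FlagAdaptedUpTo m k n M ↔ WordTame n k M₀ M₁` (`k + 2 ≤ n`), hence
`FlagCheap ↔ WordCheap` for affine pencils and `HeavyTopLaw ↔ HeavyTopWordLaw`, `FlagCostLaw ↔ FlagCostWordLaw`:
the open content of R2 / S3b is a statement about NONZERO-WORD PROFILES of the pairs `(N(x), N_lin(v))`, with the
refuter's kill `not_flagCheap_of_words` (one `N_lin`-rich nonzero short word per large `K`).  File sorries stay 1
(`stub_heavyTopLaw`); `dualUnipotentThreeHalves_of_heavyTopWord : HeavyTopWordLaw → DualUnipotentThreeHalves`.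
§8 (g4, director R227) = THE FINITE INSTANCES `HeavyTopInst n m` of R2 (`heavyTopLaw_iff_inst`), sorry-free: the
quadratic band `m(m−1)/2 + n < n²` is TRUE (`heavyTopInst_of_choose_two_add_lt`, incl. every `m ≤ n`; tops are
nilpotent + Gerstenhaber + kernel certificate); the `n = 3` column is SETTLED as far as the kernel reaches
(`instanceTable_n3`): `m ≤ 3` true, `m = 4 ⟺ SqZeroInSix` (Gerstenhaber's EQUALITY case at `4 × 4`, true in print,
not in the tree; `heavyTopInst_three_four_iff`), `m = 5` FALSE (`not_heavyTopInst_three_five`, explicit pencil `NFive`),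
`m ≥ 6` inadmissible for `C₀ = 1`.  The false format `(3,5)` is a tiny-`n` constant artefact and does NOT refute R2
(`n₀ ≥ 4` or `C₀ ≥ 2`); 24318 stays open.
-/

set_option linter.dupNamespace false

noncomputable section

namespace Summit.ValiantsHypothesis.ValiantsHypothesis.Cruxes.DualUnipotentThreeHalves.RadicalSplit

open MvPolynomial Matrix
open scoped BigOperators
open Literature.Computability.AlgebraicComplexity
open Summit.ValiantsHypothesis.ValiantsHypothesis.Cruxes.TwoDimCoefficients.DimTwoCases
open Summit.ValiantsHypothesis.ValiantsHypothesis.Theses.GrenetZeon (DualUnipotentThreeHalves)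

/-! ## §0 Interface shared with `slow_planes` (verbatim) -/

/-- The substitution `X_c ↦ x_c + v_c · s` into one-variable polynomials (`s = X 0`). -/
def lineSubst {σ : Type*} (x v : σ → ℂ) : MvPolynomial σ ℂ →ₐ[ℂ] MvPolynomial (Fin 1) ℂ :=
  aeval fun c => (C (x c) + ∑ t : Fin 1, C (v c) * X t : MvPolynomial (Fin 1) ℂ)

theorem lineSubst_eq {σ : Type*} (x v : σ → ℂ) :
    lineSubst x v = aeval fun c => (C (x c) + ∑ t : Fin (0 + 1), C ((fun _ : Fin (0 + 1) => v) t c) * X t :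
      MvPolynomial (Fin (0 + 1)) ℂ) := rfl

/-- Affine entries stay affine along a line. -/
theorem totalDegree_lineSubst_le_one {σ : Type*} [Fintype σ] (x v : σ → ℂ) {g : MvPolynomial σ ℂ}
    (hg : g.totalDegree ≤ 1) : (lineSubst x v g).totalDegree ≤ 1 := by
  rw [lineSubst_eq]
  exact totalDegree_aeval_line_le_one x (fun _ : Fin (0 + 1) => v) hg

/-- `v` has permanental rank `≤ k`: all its `(k+1) × (k+1)` subpermanents vanish. -/
def PermRankLE (n k : ℕ) (v : Fin n × Fin n → ℂ) : Prop :=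
  ∀ (r c : Fin (k + 1) ↪ Fin n), (Matrix.of fun i j => v (r i, c j)).permanent = 0

/-- `K` is LINE-FLAT of order `k` for `per_n`. -/
def LineFlat (n k : ℕ) (K : Submodule ℂ (Fin n × Fin n → ℂ)) : Prop :=
  ∀ x v : Fin n × Fin n → ℂ, v ∈ K → (lineSubst x v (perPoly (Fin n) ℂ)).totalDegree ≤ k

/-- **S1 (per-specific, folklore, size M)** — identical to `SlowPlanes.PermRankOfLineFlat`. -/
def PermRankOfLineFlat : Prop :=
  ∀ (n k : ℕ) (K : Submodule ℂ (Fin n × Fin n → ℂ)), LineFlat n k K → ∀ v ∈ K, PermRankLE n k v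

/-- **S2 (GUTERMAN–MESHULAM–SPIRIDONOV 2023, Cor. 1.6; arXiv:2212.11193; size L)** — identical to
`SlowPlanes.GMSBound`. -/
def GMSBound : Prop :=
  ∀ (n k : ℕ) (K : Submodule ℂ (Fin n × Fin n → ℂ)), (∀ v ∈ K, PermRankLE n k v) → Module.finrank ℂ K ≤ k * n

/-- **S3 — SLOW PLANE** — identical to `SlowPlanes.SlowPlane`; in THIS line it is a proved consequence of
S3a + S3b (`slowPlane_of_flagCost`), not a stub. -/
def SlowPlane : Prop :=
  ∃ C₀ n₀ : ℕ, ∀ n ≥ n₀, ∀ m : ℕ, C₀ * m ^ 2 < n ^ 3 → ∀ N : AffMat n m, IsAffine N → N ^ m = 0 →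
    ∃ (K : Submodule ℂ (Fin n × Fin n → ℂ)) (k : ℕ),
      (∀ x v : Fin n × Fin n → ℂ, v ∈ K → ∀ i j : Fin m, (((N.map (lineSubst x v)) ^ (n - 1)) i j).totalDegree ≤ k) ∧
      (k + 1) * n < Module.finrank ℂ K

/-! ## §1 Flags, potentials, and the two halves of S3 -/

/-- Degree budget of a flag with `p` levels, drop `r`, climb weight `a+1`, over words of length `n-1`. -/
def flagDeg (p r a n : ℕ) : ℕ := (p - 1 + r * (n - 1)) / (a + 1)

/-- `M(s)` is ADAPTED to the levels `lvl` with drop `r` and weight `a+1`: the `s^e`-part of the `(i,j)` entry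
is nonzero only if `(a+1)·e + lvl j ≤ lvl i + r`.  (`e = 0`: the constant part lowers the level by at most
`r`; `e = 1`: the linear part raises it by at least `a+1-r`; for the census instances `a = r`, climb `1`.) -/
def FlagAdapted {m : ℕ} (lvl : Fin m → ℕ) (r a : ℕ) (M : Matrix (Fin m) (Fin m) (MvPolynomial (Fin 1) ℂ)) :
    Prop :=
  ∀ (i j : Fin m) (d : Fin 1 →₀ ℕ), coeff d (M i j) ≠ 0 → (a + 1) * d 0 + lvl j ≤ lvl i + r

/-- `M(s)` is adapted, after a constant change of basis, to SOME flag of degree budget `≤ k`. -/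
def FlagAdaptedUpTo (m k n : ℕ) (M : Matrix (Fin m) (Fin m) (MvPolynomial (Fin 1) ℂ)) : Prop :=
  ∃ (g : (Matrix (Fin m) (Fin m) ℂ)ˣ) (lvl : Fin m → ℕ) (p r a : ℕ),
    (∀ i, lvl i < p) ∧ flagDeg p r a n ≤ k ∧
    FlagAdapted lvl r a ((g : Matrix (Fin m) (Fin m) ℂ).map C * M * (↑g⁻¹ : Matrix (Fin m) (Fin m) ℂ).map C)

/-- The pencil `N` is FLAG-CHEAP: some direction space `K` and order `k` with `(k+1)·n < dim K` such that
along every line `x + s v`, `v ∈ K`, the substituted pencil is adapted (up to a constant change of basis that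
may depend on the line) to a flag of budget `≤ k`.  The INVARIANT of the verdict is
`κ(N) := min over (K, flags) of codim K + (k+1)·n`; flag-cheap means `κ(N) < n²`. -/
def FlagCheap (n m : ℕ) (N : AffMat n m) : Prop :=
  ∃ (K : Submodule ℂ (Fin n × Fin n → ℂ)) (k : ℕ),
    (∀ x v : Fin n × Fin n → ℂ, v ∈ K → FlagAdaptedUpTo m k n (N.map (lineSubst x v))) ∧
    (k + 1) * n < Module.finrank ℂ K

/-- **S3a — RUN BOUND** (per-agnostic, PROVED below as `runBound_proof`): flag-cheap ⇒ slow plane. -/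
def RunBound : Prop :=
  ∀ (n m : ℕ) (N : AffMat n m), FlagCheap n m N →
    ∃ (K : Submodule ℂ (Fin n × Fin n → ℂ)) (k : ℕ),
      (∀ x v : Fin n × Fin n → ℂ, v ∈ K → ∀ i j : Fin m, (((N.map (lineSubst x v)) ^ (n - 1)) i j).totalDegree ≤ k) ∧
      (k + 1) * n < Module.finrank ℂ K

/-- **S3b — FLAG-COST LAW** (per-agnostic; the residual crux of `flag_cost`; in THIS line it is DERIVED
from R1 + R2 by `flagCostLaw_of_split`).  Every affine nilpotent
`m × m` pencil over `Mat_n(ℂ)` with `C₀·m² < n³` is flag-cheap.  TRUE on every family of the wild census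
(one uniform flag each, see the module docstring); content only for coefficient spaces of dimension
`δ ≥ n² - n`.  Why it might fail: an irreducible-top-heavy nilpotent space at `δ ≈ m^{4/3}` expensive for every
bounded-drop flag, or a pencil slow only by cancellation. [this line; MOR 1991; crit-3 #9/#14; GMS 2023] -/
def FlagCostLaw : Prop :=
  ∃ C₀ n₀ : ℕ, ∀ n ≥ n₀, ∀ m : ℕ, C₀ * m ^ 2 < n ^ 3 → ∀ N : AffMat n m, IsAffine N → N ^ m = 0 →
    FlagCheap n m N

/-! ## §1b The Wedderburn split of S3b -/

/-- The unital matrix algebra `𝒜(N)` generated by the values `N(x)`, `x ∈ ℂ^{n×n}`, of the pencil. -/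
def pencilAlg {n m : ℕ} (N : AffMat n m) : Subalgebra ℂ (Matrix (Fin m) (Fin m) ℂ) :=
  Algebra.adjoin ℂ (Set.range fun x : Fin n × Fin n → ℂ => N.map (MvPolynomial.eval x))

/-- Linear part of the pencil in direction `v`: `N(v) − N(0)`. -/
def linPart {n m : ℕ} (N : AffMat n m) (v : Fin n × Fin n → ℂ) : Matrix (Fin m) (Fin m) ℂ :=
  N.map (MvPolynomial.eval v) - N.map (MvPolynomial.eval 0)

/-- `K` is TRACE-ORTHOGONAL to the pencil algebra: `tr(N_lin(v)·b) = 0` for `v ∈ K`, `b ∈ 𝒜(N)`;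
equivalently (trace-form characterisation of the radical, char 0) `N_lin(K) ⊆ rad 𝒜(N)`. -/
def RadOrth (n m : ℕ) (N : AffMat n m) (K : Submodule ℂ (Fin n × Fin n → ℂ)) : Prop :=
  ∀ v ∈ K, ∀ b ∈ pencilAlg N, Matrix.trace (linPart N v * b) = 0

/-- **R1 — RADICAL COARSENING** (per-agnostic theorem candidate): a large trace-orthogonal direction
space makes the pencil flag-cheap (Loewy flag of `𝒜(N)`, greedy coarsening, `r = a = 0`). -/
def RadicalCoarsening : Prop :=
  ∀ (n m : ℕ) (N : AffMat n m), IsAffine N → ∀ K : Submodule ℂ (Fin n × Fin n → ℂ), RadOrth n m N K →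
    16 * m * Nat.sqrt n + 16 * n < Module.finrank ℂ K → FlagCheap n m N

/-- **R2 — HEAVY-TOP LAW** (the residual crux of this line; LAW tier): below `C₀m² < n³`, a nilpotent
pencil all of whose trace-orthogonal direction spaces are small (semisimple-top-heavy) is flag-cheap.
[this line; MOR 1991; de Seguins Pazzis 2025; crit-3 #9/#14/#14a] -/
def HeavyTopLaw : Prop :=
  ∃ C₀ n₀ : ℕ, ∀ n ≥ n₀, ∀ m : ℕ, C₀ * m ^ 2 < n ^ 3 → ∀ N : AffMat n m, IsAffine N → N ^ m = 0 →
    (∀ K : Submodule ℂ (Fin n × Fin n → ℂ), RadOrth n m N K →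
      Module.finrank ℂ K ≤ 16 * m * Nat.sqrt n + 16 * n) →
    FlagCheap n m N

/-! ## §2b (placed before the stubs since the S2 discharge) S2 from the landed Literature fact, BY NAME (val-idea-9 g3, 09:11Z; fact DISCHARGED p622922 09:53Z)
`Literature.LinearAlgebra.GutermanMeshulamSpiridonov2023_cor_1_6` (p619424 @eb90aa6b1e0b, port hand val-port-1 g1, lit VET g16;
typed OPEN — Cor. 1.6 of arXiv:2212.11193 is NOT proved in the tree, so `stub_gms` above keeps its `sorry`): the fact is
stated with the tree's permanental rank `BoraleviCarliniMichalekVentura2025.prk`; the two theorems below are the sorry-free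
bookkeeping bridge to this line's `GMSBound` (embedding form of "prk ≤ k"), so that the line is conditional on the fact BY NAME
(`dualUnipotentThreeHalves_of_fact`, end of file). -/

/-- `PermRankLE n k v` (all `(k+1) × (k+1)` subpermanents along injections vanish) ⇒ the tree's permanental rank of the
matrix `(v (i,j))` is `≤ k` — via `forall_rsubperm_eq_zero_iff_prk_lt` and `Matrix.subperm_eq_permanent_of_equiv`. -/
theorem prk_le_of_permRankLE {n k : ℕ} {v : Fin n × Fin n → ℂ} (h : PermRankLE n k v) :
    Literature.Computability.AlgebraicComplexity.BoraleviCarliniMichalekVentura2025.prk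
      (Matrix.of fun i j : Fin n => v (i, j)) ≤ k := by
  classical
  set A : Matrix (Fin n) (Fin n) ℂ := Matrix.of fun i j : Fin n => v (i, j) with hA
  have hlt : Literature.Computability.AlgebraicComplexity.BoraleviCarliniMichalekVentura2025.prk A < k + 1 := by
    rw [← Literature.Computability.AlgebraicComplexity.BoraleviCarliniMichalekVentura2025.forall_rsubperm_eq_zero_iff_prk_lt
      A (h := k + 1) (by omega)]
    intro Rw Cl hR hC
    have eR : Fin (k + 1) ≃ {j // j ∈ Rw} :=
      (Finset.equivFinOfCardEq hR).symm.trans (Equiv.subtypeEquivRight (fun _ => Iff.rfl))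
    have eC : Fin (k + 1) ≃ {i // i ∈ Cl} :=
      (Finset.equivFinOfCardEq hC).symm.trans (Equiv.subtypeEquivRight (fun _ => Iff.rfl))
    rw [Literature.Computability.AlgebraicComplexity.BoraleviCarliniMichalekVentura2025.rsubperm_eq_subperm,
      Matrix.subperm_eq_permanent_of_equiv A eC eR]
    let r : Fin (k + 1) ↪ Fin n := ⟨fun a => (eR a : Fin n), fun a b hab => eR.injective (Subtype.ext hab)⟩
    let c : Fin (k + 1) ↪ Fin n := ⟨fun a => (eC a : Fin n), fun a b hab => eC.injective (Subtype.ext hab)⟩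
    have hmat : (Matrix.of fun a b => A (eR a : Fin n) (eC b : Fin n)) = Matrix.of fun i j => v (r i, c j) := by
      ext a b; simp [hA, r, c]
    rw [hmat]
    exact h r c
  omega

/-- **S2 BY NAME**: the landed Literature fact (GMS 2023 Cor. 1.6 over `ℂ`, tree-`prk` form) implies this line's
`GMSBound` — transport along `LinearEquiv.curry` and `prk_le_of_permRankLE`. Sorry-free. -/
theorem gmsBound_of_fact (hF : Literature.LinearAlgebra.GutermanMeshulamSpiridonov2023_cor_1_6 ℂ) : GMSBound := by
  classical
  intro n k K hK
  let e : (Fin n × Fin n → ℂ) ≃ₗ[ℂ] Matrix (Fin n) (Fin n) ℂ :=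
    (LinearEquiv.curry ℂ ℂ (Fin n) (Fin n)).trans (LinearEquiv.refl ℂ _)
  have hW : ∀ A ∈ K.map (e : (Fin n × Fin n → ℂ) →ₗ[ℂ] Matrix (Fin n) (Fin n) ℂ),
      Literature.Computability.AlgebraicComplexity.BoraleviCarliniMichalekVentura2025.prk A ≤ k := by
    intro A hA
    obtain ⟨v, hv, rfl⟩ := Submodule.mem_map.1 hA
    have : (e : (Fin n × Fin n → ℂ) →ₗ[ℂ] _) v = Matrix.of fun i j : Fin n => v (i, j) := by
      ext i j; rfl
    rw [this]
    exact prk_le_of_permRankLE (hK v hv)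
  have := hF n k (K.map (e : (Fin n × Fin n → ℂ) →ₗ[ℂ] Matrix (Fin n) (Fin n) ℂ)) hW
  rwa [LinearEquiv.finrank_map_eq] at this

/-! ## §2 Registered stubs -/

theorem stub_permRank_of_lineFlat : PermRankOfLineFlat := by
  -- LANDED (`…Theorems.GrenetZeonDualUnipotentThreeHalvesPermRankOfLineFlat`, `GrenetZeon.SlowPlanes.permRank_of_lineFlat`,
  -- S1 with LineFlat/lineSubst/PermRankLE unfolded verbatim): by-name citation, δ-unfold (port hand val-port-1 g1, val-lit RULING #254 (b)(iv)).
  exact Summit.ValiantsHypothesis.ValiantsHypothesis.Theorems.GrenetZeon.SlowPlanes.permRank_of_lineFlat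
theorem stub_gms : GMSBound :=
  -- S2 is a THEOREM by name: the Literature fact `Literature.LinearAlgebra.GutermanMeshulamSpiridonov2023_cor_1_6` was
  -- DISCHARGED (p622922 `Literature/LinearAlgebra/GMSPermanentalRankSubspaceHolds.lean :: …_cor_1_6_holds`, val-lit-p9 g1,
  -- [paper:arxiv-2212.11193 §2]) and §2b's sorry-free bridge `gmsBound_of_fact` converts it to this line's `GMSBound`.
  gmsBound_of_fact (Literature.LinearAlgebra.GutermanMeshulamSpiridonov2023_cor_1_6_holds ℂ)

theorem stub_radicalCoarsening : RadicalCoarsening :=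
  -- R1 is a THEOREM by name: `Theorems/GrenetZeonDualUnipotentThreeHalvesRadicalCoarsening.lean :: …RadicalCoarsening.radicalCoarsening`
  -- (port hand val-port-3 g0, 2026-08-28 10:04Z; bricks B1 p621559 / B2 p621964 / B2c FineFlag; closed-form coarsening
  -- ⌊(m − dim F_{lvl i})/λ⌋ with λ = ⌊√n⌋, cross pairs < λ per row, k = (m−1)/λ), statement = this def UNFOLDED (δ-unfold citation).
  Summit.ValiantsHypothesis.ValiantsHypothesis.Theorems.GrenetZeon.RadicalCoarsening.radicalCoarsening

theorem stub_heavyTopLaw : HeavyTopLaw := by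
  sorry

/-! ## §2c R1, FINE-FLAG CASE — kernel theorem BY NAME (port hand val-port-3 g0, bricks B1 p621559 / B2a–b p621964 / B2c)
`…Theorems.GrenetZeon.RadicalCoarsening.flagCheap_of_radOrth_of_loewy_length`: if `K` is radical-orthogonal and the Jacobson
radical of the pencil algebra `𝒜(N)` has Loewy length `L ≥ 1` with `L·n < dim K`, then `N` is flag-cheap — witnessed by `K′ = K`,
`k = L − 1`, `r = a = 0`, levels = Loewy layers, ONE adapted basis `g` for every line (B2c `flagAdaptedUpTo_of_coeffs`; B1
`linPart_mem_jacobson_of_radOrth` = trace-orthogonal ⇒ Jacobson via the tree's `isNilpotent_of_forall_trace_pow_eq_zero`).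
This is R1 (`RadicalCoarsening`) in the regime `L·n < dim K`; the registered R1 (hypothesis `16·m·⌊√n⌋ + 16·n < dim K`, no
condition on `L ≤ m`) additionally needs BRICK 3 (greedy run-coarsening with direction loss, card §R1 PORT ROUTE (P-c)). -/

theorem r1_fine_of_loewy_length {n m : ℕ} (N : AffMat n m) (hN : IsAffine N)
    (K : Submodule ℂ (Fin n × Fin n → ℂ)) (hK : RadOrth n m N K) {L : ℕ} (hL1 : 1 ≤ L)
    (hL : (Ideal.jacobson (⊥ : Ideal (pencilAlg N))) ^ L = ⊥) (hdim : L * n < Module.finrank ℂ K) :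
    FlagCheap n m N :=
  Summit.ValiantsHypothesis.ValiantsHypothesis.Theorems.GrenetZeon.RadicalCoarsening.flagCheap_of_radOrth_of_loewy_length
    N hN K hK hL1 hL hdim

/-! ## §3 S3a (the run bound) — LANDED as a Theorems theorem, cited BY NAME (δ-unfold)
p621562 `Theorems/GrenetZeonDualUnipotentThreeHalvesFlagCostRunBound.lean` (port hand val-port-1 g1, desk RULING #272 (c)/#273 (e),
credit this line): `…Theorems.GrenetZeon.FlagCost.runBound` with the helpers `coeff_pow_of_flagAdapted` (potential bookkeeping:
`coeff_{s^e} (M^L)_{ij} ≠ 0 ⇒ (a+1)·e + lvl j ≤ lvl i + r·L`), `totalDegree_pow_le_flagDeg`, `conj_pow_eq`, `totalDegree_conj_le`, and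
`slowPlane_of_runBound_flagCostLaw`; statements = this file's defs UNFOLDED token-for-token.  The in-file proofs (rev ≤ @ee0357ae2957 /
@36421954d9b5) are superseded by the citation below. -/

/-- **S3a holds** — by name from the Theorems file (sorry-free). -/
theorem runBound_proof : RunBound :=
  Summit.ValiantsHypothesis.ValiantsHypothesis.Theorems.GrenetZeon.FlagCost.runBound

/-- S3a + S3b ⇒ S3. -/
theorem slowPlane_of_flagCost (ha : RunBound) (hb : FlagCostLaw) : SlowPlane := by
  obtain ⟨C₀, n₀, h⟩ := hb
  exact ⟨C₀, n₀, fun n hn m hm N hN hnil => ha n m N (h n hn m hm N hN hnil)⟩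

/-! ## §4 Composition (sorry-free) -/

/-- Degree of the pulled-back trace product: entries of `N'^d` of degree `≤ k`, `M` affine ⇒ `≤ k + 1`. -/
theorem totalDegree_lineSubst_trace_le {n m d k : ℕ} (N M : AffMat n m) (hM : IsAffine M)
    (x v : Fin n × Fin n → ℂ)
    (hdeg : ∀ i j : Fin m, (((N.map (lineSubst x v)) ^ d) i j).totalDegree ≤ k) :
    (lineSubst x v ((N ^ d * M).trace)).totalDegree ≤ k + 1 := by
  set θ := lineSubst x v with hθ
  have hmap : θ ((N ^ d * M).trace) = ((N.map θ) ^ d * M.map θ).trace := by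
    rw [show N.map θ = θ.toRingHom.mapMatrix N from rfl,
      show M.map θ = θ.toRingHom.mapMatrix M from rfl, ← map_pow, ← map_mul]
    simp only [Matrix.trace, Matrix.diag_apply, map_sum, RingHom.mapMatrix_apply, Matrix.map_apply]
    rfl
  rw [hmap, Matrix.trace]
  simp only [Matrix.diag_apply, Matrix.mul_apply]
  have hbound : ∀ i j : Fin m, (((N.map θ) ^ d) i j * (M.map θ) j i).totalDegree ≤ k + 1 := by
    intro i j
    have h1 := hdeg i j
    have h2 : ((M.map θ) j i).totalDegree ≤ 1 := by
      rw [Matrix.map_apply]; exact totalDegree_lineSubst_le_one x v (hM j i)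
    have h3 := totalDegree_mul (((N.map θ) ^ d) i j) ((M.map θ) j i)
    omega
  refine (totalDegree_finsetSum _ _).trans (Finset.sup_le fun i _ => ?_)
  exact (totalDegree_finsetSum _ _).trans (Finset.sup_le fun j _ => hbound i j)

/-- Through `SlowPlane` (verbatim from `slow_planes`). -/
theorem dualUnipotentThreeHalves_of_slowPlane (h1 : PermRankOfLineFlat) (h2 : GMSBound) (h3 : SlowPlane) :
    DualUnipotentThreeHalves := by
  obtain ⟨C₀, n₀, hC⟩ := h3
  refine ⟨C₀, n₀ + 1, ?_⟩
  intro n hn m hrep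
  have hrep' : DualUnipotentRepr n m := hrep
  have hn1 : 1 ≤ n := by omega
  by_contra hlt
  have hlt' : C₀ * m ^ 2 < n ^ 3 := by omega
  obtain ⟨N, M, hN, hM, hnil, hper⟩ := exists_nilpotent_pencil_of_dualUnipotentRepr hn1 hrep'
  have haffN : IsAffine N := fun i j => (hN i j).totalDegree_le
  have haffM : IsAffine M := fun i j => (hM i j).totalDegree_le
  obtain ⟨K, k, hdeg, hdim⟩ := hC n (by omega) m hlt' N haffN hnil
  have hflat : LineFlat n (k + 1) K := by
    intro x v hv
    rw [hper]
    exact totalDegree_lineSubst_trace_le N M haffM x v (hdeg x v hv)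
  have hrk := h1 n (k + 1) K hflat
  have hfin := h2 n (k + 1) K hrk
  omega

/-! ## §5 The Wedderburn split: R1 + R2 ⇒ S3b, and the line -/

/-- R1 + R2 ⇒ S3b (case split on the existence of a large trace-orthogonal direction space). -/
theorem flagCostLaw_of_split (hR1 : RadicalCoarsening) (hR2 : HeavyTopLaw) : FlagCostLaw := by
  obtain ⟨C₀, n₀, h⟩ := hR2
  refine ⟨C₀, n₀, fun n hn m hm N hN hnil => ?_⟩
  by_cases hK : ∃ K : Submodule ℂ (Fin n × Fin n → ℂ),
      RadOrth n m N K ∧ 16 * m * Nat.sqrt n + 16 * n < Module.finrank ℂ K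
  · obtain ⟨K, hK1, hK2⟩ := hK
    exact hR1 n m N hN K hK1 hK2
  · push Not at hK
    exact h n hn m hm N hN hnil hK

/-- Through `flag_cost`: S1 + S2 + S3a + S3b ⇒ the 3/2 rung (verbatim). -/
theorem dualUnipotentThreeHalves_of_flagCost (h1 : PermRankOfLineFlat) (h2 : GMSBound) (h3a : RunBound)
    (h3b : FlagCostLaw) : DualUnipotentThreeHalves :=
  dualUnipotentThreeHalves_of_slowPlane h1 h2 (slowPlane_of_flagCost h3a h3b)

/-- **The line.**  S1 + S2 (per-specific) + R1 (radical coarsening) + R2 (heavy-top law) ⇒ the 3/2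
rung; S3a is discharged by `runBound_proof`. -/
theorem dualUnipotentThreeHalves_of (h1 : PermRankOfLineFlat) (h2 : GMSBound) (hR1 : RadicalCoarsening)
    (hR2 : HeavyTopLaw) : DualUnipotentThreeHalves :=
  dualUnipotentThreeHalves_of_flagCost h1 h2 runBound_proof (flagCostLaw_of_split hR1 hR2)

/-- The target through the registered stubs. -/
theorem dualUnipotentThreeHalves_via_stubs : DualUnipotentThreeHalves :=
  dualUnipotentThreeHalves_of stub_permRank_of_lineFlat stub_gms stub_radicalCoarsening stub_heavyTopLaw

/-- **The line, conditional on the Literature fact BY NAME** (S1 landed, S2 = GMS fact via `gmsBound_of_fact`,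
S3a proved here): `GMS Cor 1.6 (ℂ) → RadicalCoarsening → HeavyTopLaw → DualUnipotentThreeHalves`, no `sorry` on this path. -/
theorem dualUnipotentThreeHalves_of_fact
    (hF : Literature.LinearAlgebra.GutermanMeshulamSpiridonov2023_cor_1_6 ℂ)
    (hR1 : RadicalCoarsening) (hR2 : HeavyTopLaw) : DualUnipotentThreeHalves :=
  dualUnipotentThreeHalves_of stub_permRank_of_lineFlat (gmsBound_of_fact hF) hR1 hR2

/-- **Annex A in the kernel, fact-free:** crux 24318 ⟸ R1 `RadicalCoarsening` (theorem-sized; fine-flag case landed §2c) + the LAW R2 `HeavyTopLaw` (S1, S2, S3a by name). -/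
theorem dualUnipotentThreeHalves_of_law (hR1 : RadicalCoarsening) (hR2 : HeavyTopLaw) : DualUnipotentThreeHalves :=
  dualUnipotentThreeHalves_of stub_permRank_of_lineFlat stub_gms hR1 hR2

/-- **After R1 (p623799): S3b ⟸ the LAW R2 alone.** -/
theorem flagCostLaw_of_heavyTop (hR2 : HeavyTopLaw) : FlagCostLaw :=
  flagCostLaw_of_split stub_radicalCoarsening hR2

/-- **Annex A in the kernel after R1, fact-free:** crux 24318 ⟸ the LAW `HeavyTopLaw` ALONE (S1, S2, S3a, R1 are theorems by name). -/
theorem dualUnipotentThreeHalves_of_heavyTop (hR2 : HeavyTopLaw) : DualUnipotentThreeHalves :=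
  dualUnipotentThreeHalves_of_law stub_radicalCoarsening hR2

/-! ## §6 R2 DOSSIER bricks (val-idea-9 g3, kernel-checked, sorry-free): (D2) trace isotropy of nilpotent pencils, (D3) core rigidity

These are NOT stubs and NOT on the proof path of any registered item; they are the two elementary facts the
R2 dossier of the card (`Lines/radical_split.md` (D2), (D3)) leans on, typed so that a future seat on `HeavyTopLaw`
can cite them by name from this workfile (or re-land them under `Theorems/`).  (D2) is Mathes–Omladič–Radjavi 1991,
Lemmas 1–2 (char 0; here over `ℂ` via continuity in the pencil parameter); (D3) says a POWER-FAT strictly upper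
triangular core forces the whole nilpotent space into `𝔫_m` (no twist), so any counterexample to R2 has a power-thin core. -/
section R2Dossier

variable {m : ℕ}


/-- Telescoping in a (noncommutative) ring: `X^(k+1) - Y^(k+1) = ∑_{i ≤ k} X^i (X - Y) Y^(k-i)`. -/
theorem pow_sub_pow_telescope {R : Type*} [Ring R] (X Y : R) (k : ℕ) :
    X ^ (k + 1) - Y ^ (k + 1) = ∑ i ∈ Finset.range (k + 1), X ^ i * (X - Y) * Y ^ (k - i) := by
  induction k with
  | zero => simp
  | succ k ih =>
    rw [Finset.sum_range_succ, Nat.sub_self, pow_zero, mul_one]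
    have h : ∑ i ∈ Finset.range (k + 1), X ^ i * (X - Y) * Y ^ (k + 1 - i)
        = (∑ i ∈ Finset.range (k + 1), X ^ i * (X - Y) * Y ^ (k - i)) * Y := by
      rw [Finset.sum_mul]
      refine Finset.sum_congr rfl fun i hi => ?_
      have hi' : i ≤ k := Nat.lt_succ_iff.mp (Finset.mem_range.mp hi)
      rw [show k + 1 - i = (k - i) + 1 by omega, pow_succ]
      simp only [mul_assoc]
    rw [h, ← ih]
    noncomm_ring

/-- **(D2) Trace isotropy of a nilpotent pencil (char 0).** If `A + t • B` is nilpotent for every `t : ℂ`,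
then `tr (A^k * B) = 0` for every `k`. -/
theorem trace_pow_mul_eq_zero_of_pencil (A B : Matrix (Fin m) (Fin m) ℂ)
    (h : ∀ t : ℂ, IsNilpotent (A + t • B)) (k : ℕ) : Matrix.trace (A ^ k * B) = 0 := by
  -- g t := ∑_{i ≤ k} tr ((A + tB)^i * B * A^(k-i)); for t ≠ 0, t * g t = tr((A+tB)^(k+1)) - tr(A^(k+1)) = 0.
  set g : ℂ → ℂ := fun t => ∑ i ∈ Finset.range (k + 1), Matrix.trace ((A + t • B) ^ i * B * A ^ (k - i)) with hg
  have hA : IsNilpotent A := by simpa using h 0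
  have key : ∀ t : ℂ, t * g t = 0 := by
    intro t
    have h1 : Matrix.trace ((A + t • B) ^ (k + 1)) = 0 :=
      Matrix.isNilpotent_trace_of_isNilpotent ((h t).pow_succ k) |>.eq_zero
    have h2 : Matrix.trace (A ^ (k + 1)) = 0 :=
      Matrix.isNilpotent_trace_of_isNilpotent (hA.pow_succ k) |>.eq_zero
    have h3 := congrArg Matrix.trace (pow_sub_pow_telescope (A + t • B) A k)
    rw [Matrix.trace_sub, h1, h2, sub_zero, Matrix.trace_sum] at h3
    rw [hg]; simp only
    rw [Finset.mul_sum]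
    refine (Eq.trans (Finset.sum_congr rfl fun i _ => ?_) h3.symm)
    rw [add_sub_cancel_left, Matrix.mul_smul, Matrix.smul_mul, Matrix.trace_smul, smul_eq_mul]
  have hcont : Continuous g := by
    rw [hg]
    refine continuous_finset_sum _ fun i _ => ?_
    have hf : Continuous fun t : ℂ => A + t • B := continuous_const.add (continuous_id.smul continuous_const)
    exact (((hf.pow i).mul continuous_const).mul continuous_const).matrix_trace
  have hzero : ∀ t : ℂ, t ≠ 0 → g t = 0 := fun t ht => by
    have := key t
    rcases mul_eq_zero.mp this with h0 | h0
    · exact absurd h0 ht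
    · exact h0
  have hg0 : g 0 = 0 := by
    -- density of `{t ≠ 0}` and continuity
    have hdense : Dense ({0}ᶜ : Set ℂ) := dense_compl_singleton 0
    have heq : Set.EqOn g 0 ({0}ᶜ : Set ℂ) := fun t ht => hzero t (Set.mem_compl_singleton_iff.mp ht)
    have hfun := Continuous.ext_on hdense hcont continuous_zero heq
    exact congrFun hfun 0
  -- g 0 = (k+1) • tr (A^k * B)
  have hg0' : g 0 = ∑ i ∈ Finset.range (k + 1), Matrix.trace (A ^ k * B) := by
    rw [hg]; simp only [zero_smul, add_zero]
    refine Finset.sum_congr rfl fun i hi => ?_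
    have hi' : i ≤ k := Nat.lt_succ_iff.mp (Finset.mem_range.mp hi)
    rw [Matrix.trace_mul_cycle, ← pow_add, show k - i + i = k by omega]
  rw [hg0', Finset.sum_const, Finset.card_range, nsmul_eq_mul] at hg0
  have hk : ((k + 1 : ℕ) : ℂ) ≠ 0 := by exact_mod_cast Nat.succ_ne_zero k
  exact (mul_eq_zero.mp hg0).resolve_left hk

/-- Trace orthogonality extends linearly from powers of members of `L` to their span. -/
theorem trace_mul_eq_zero_of_mem_span_powers (L : Submodule ℂ (Matrix (Fin m) (Fin m) ℂ))
    (hL : ∀ A ∈ L, IsNilpotent A) (S : Set (Matrix (Fin m) (Fin m) ℂ))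
    (hS : ∀ X ∈ S, ∃ u ∈ L, ∃ k : ℕ, X = u ^ k)
    {X : Matrix (Fin m) (Fin m) ℂ} (hX : X ∈ Submodule.span ℂ S)
    {B : Matrix (Fin m) (Fin m) ℂ} (hB : B ∈ L) : Matrix.trace (X * B) = 0 := by
  induction hX using Submodule.span_induction with
  | mem X hXS =>
    obtain ⟨u, hu, k, rfl⟩ := hS X hXS
    refine trace_pow_mul_eq_zero_of_pencil u B (fun t => hL _ ?_) k
    exact L.add_mem hu (L.smul_mem t hB)
  | zero => simp
  | add X Y _ _ hX hY => rw [Matrix.add_mul, Matrix.trace_add, hX, hY, add_zero]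
  | smul c X _ hX => rw [Matrix.smul_mul, Matrix.trace_smul, hX, smul_zero]

/-- Diagonal entries of powers of a (weakly) upper-triangular matrix. -/
theorem pow_apply_of_upper (B : Matrix (Fin m) (Fin m) ℂ) (hB : ∀ a b : Fin m, b < a → B a b = 0) (k : ℕ) :
    (∀ a b : Fin m, b < a → (B ^ k) a b = 0) ∧ ∀ a : Fin m, (B ^ k) a a = B a a ^ k := by
  induction k with
  | zero =>
    refine ⟨fun a b hab => ?_, fun a => ?_⟩
    · rw [pow_zero, Matrix.one_apply_ne (ne_of_gt hab)]
    · rw [pow_zero, pow_zero, Matrix.one_apply_eq]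
  | succ k ih =>
    obtain ⟨ih1, ih2⟩ := ih
    refine ⟨fun a b hab => ?_, fun a => ?_⟩
    · rw [pow_succ, Matrix.mul_apply]
      refine Finset.sum_eq_zero fun c _ => ?_
      by_cases hca : c < a
      · rw [ih1 a c hca, zero_mul]
      · have hbc : b < c := lt_of_lt_of_le hab (not_lt.mp hca)
        rw [hB c b hbc, mul_zero]
    · rw [pow_succ, Matrix.mul_apply, Finset.sum_eq_single a, ih2 a, pow_succ]
      · intro c _ hca
        rcases lt_or_gt_of_ne hca with h | h
        · rw [ih1 a c h, zero_mul]
        · rw [hB c a h, mul_zero]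
      · intro h; exact absurd (Finset.mem_univ a) h

/-- **(D3) Core rigidity.** Let `L` be a linear space of nilpotent matrices. If the span of the powers of the
STRICTLY UPPER-TRIANGULAR members of `L` contains every elementary matrix `E a b` with `a < b` (a «power-fat core»),
then every member of `L` is strictly upper triangular — so `L` is triangularisable and carries no twist. -/
theorem core_rigidity (L : Submodule ℂ (Matrix (Fin m) (Fin m) ℂ)) (hL : ∀ A ∈ L, IsNilpotent A)
    (hspan : ∀ a b : Fin m, a < b → Matrix.single a b (1 : ℂ) ∈
      Submodule.span ℂ {X | ∃ u ∈ L, ∃ k : ℕ, (∀ a b : Fin m, b ≤ a → u a b = 0) ∧ X = u ^ k})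
    (B : Matrix (Fin m) (Fin m) ℂ) (hB : B ∈ L) : ∀ a b : Fin m, b ≤ a → B a b = 0 := by
  -- strictly lower entries vanish by trace orthogonality against the elementary matrices
  have hlow : ∀ a b : Fin m, b < a → B a b = 0 := by
    intro a b hba
    have h := trace_mul_eq_zero_of_mem_span_powers L hL _ (fun X hX => ?_) (hspan b a hba) hB
    · rwa [Matrix.trace_single_mul, one_smul] at h
    · obtain ⟨u, hu, k, -, rfl⟩ := hX
      exact ⟨u, hu, k, rfl⟩
  intro a b hba
  rcases lt_or_eq_of_le hba with h | h
  · exact hlow a b h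
  · subst h
    -- diagonal entries: `B` is upper triangular and nilpotent
    obtain ⟨N, hN⟩ := hL B hB
    have hN1 : B ^ (N + 1) = 0 := by rw [pow_succ, hN, zero_mul]
    have hdiag := (pow_apply_of_upper B hlow (N + 1)).2 b
    rw [hN1, Matrix.zero_apply] at hdiag
    exact pow_eq_zero_iff (Nat.succ_ne_zero N) |>.mp hdiag.symm

end R2Dossier

/-! ## §7 WORD–FLAG DUALITY (val-idea-9 g4, negation lens; kernel-checked, sorry-free) — DOSSIER (D7)

The flag layer of S3b / R2 is WORD COMBINATORICS, exactly.  The landed negative lane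
(`…Theorems.DualUnipotentThreeHalvesNegative.FlagCost.word_eq_zero_of_flagAdapted`, `level_bound_word`, p613488) is the
direction «certificate ⇒ short `M₁`-rich words vanish».  Here the CONVERSE is proved in its sharp form and the two are
closed into an `iff`: for a one-variable pencil `M(s) = M₀ + s·M₁` (no `s²`), `FlagAdaptedUpTo m k n M` holds IFF the
pair `(M₀, M₁)` is WORD-TAME with budget `k` (`WordTame`): there are a climb `c ≥ 1`, a drop `r` and a height `Θ` with
`⌊(Θ + r(n−1))/(c+r)⌋ ≤ k` such that EVERY NONZERO WORD `w` in `{M₀, M₁}` satisfies `c·#M₁(w) ≤ Θ + r·#M₀(w)`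
(`flagAdaptedUpTo_of_wordTame`; `wordTame_of_flagAdaptedUpTo` needs `k + 2 ≤ n`, automatic under `(k+1)·n < dim K`;
`flagAdaptedUpTo_iff_wordTame`).  The certifying flag is CANONICAL — the sublevel chain
`F_t = ⋂ {ker w : Θ + r·#M₀(w) < c·#M₁(w) + t}` of the word valuation — so a certificate never requires a search over
bases (`flagAdaptedUpTo_of_chain` is the general `(r, c)` form of the landed `flagAdaptedUpTo_of_flag`, FlagCoords).
Pencil level (`flagCheap_iff_wordTame`): for affine `N`,
`FlagCheap n m N ↔ ∃ K k, (k+1)·n < dim K ∧ ∀ x, ∀ v ∈ K, WordTame n k (N(x)) (N_lin(v))`;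
and the refuter's ENEMY CRITERION in word form (`not_wordTame_of_word`, `not_flagCheap_of_words`): a nonzero word of
length `≤ n − 1` with `> k` letters `N_lin(v)` on some line of every large `K` kills flag-cheapness — no flag search.
Consequences (card (D7)): exact per-pair cost `cost(P,Q) = min_{r,c} ⌊(Θ*(r,c) + r(n−1))/(r+c)⌋`,
`Θ*(r,c) = sup_{w ≠ 0} (c·#Q(w) − r·#P(w))`; R1 = the profile `r = 0` (Loewy valuation); SUF (p617241) = the profile
`c = 1, r = Θ = ν − 1`; the atomic content of R2 = «on heavy-top thin nilpotent spaces some `K` of dimension `> (k+1)n`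
carries only word-tame pairs».  Nothing here bears on `per_n` or VP ≠ VNP. [this file; folklore (weighted path
potentials / sublevel flags of a valuation); p613488 for the ⇒ half]
-/
section WordFlagDuality

open Summit.ValiantsHypothesis.ValiantsHypothesis.Theorems.GrenetZeon.RadicalCoarsening
  (exists_adapted_set coeff_conj_apply conj_entry_eq_repr toMatrix'_equivFun_mul_symm toMatrix'_symm_mul_equivFun
    coeff_map_lineSubst)
open Summit.ValiantsHypothesis.ValiantsHypothesis.Theorems.DualUnipotentThreeHalvesNegative.FlagCost
  (level_bound_word word_conj)

variable {m : ℕ}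

/-- The word of a Boolean list in two matrices (`true ↦ T₁`, `false ↦ T₀`; the convention of p613488). -/
def word (T₀ T₁ : Matrix (Fin m) (Fin m) ℂ) (w : List Bool) : Matrix (Fin m) (Fin m) ℂ :=
  (w.map fun b => if b then T₁ else T₀).prod

theorem word_nil (T₀ T₁ : Matrix (Fin m) (Fin m) ℂ) : word T₀ T₁ [] = 1 := by
  simp [word]

theorem word_append_singleton (T₀ T₁ : Matrix (Fin m) (Fin m) ℂ) (w : List Bool) (b : Bool) :
    word T₀ T₁ (w ++ [b]) = word T₀ T₁ w * (if b then T₁ else T₀) := by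
  simp [word, List.map_append, List.prod_append]

/-- **WORD-TAME with budget `k`** (the dual currency of `FlagAdaptedUpTo`): some climb `c ≥ 1`, drop `r` and height `Θ`
with `⌊(Θ + r(n−1))/(c+r)⌋ ≤ k` such that every NONZERO word has `c·#T₁ ≤ Θ + r·#T₀`. -/
def WordTame (n k : ℕ) (T₀ T₁ : Matrix (Fin m) (Fin m) ℂ) : Prop :=
  ∃ r c Θ : ℕ, 1 ≤ c ∧ (Θ + r * (n - 1)) / (c + r) ≤ k ∧
    ∀ w : List Bool, word T₀ T₁ w ≠ 0 → c * w.count true ≤ Θ + r * w.count false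

/-- **Adapted basis from a stable chain, general drop/climb** (the `(r, c)` form of the landed `flagAdaptedUpTo_of_flag`).
An antitone chain `F 0 = ⊤ ⊇ ⋯ ⊇ F L = ⊥` which the constant part `M₀` lowers by at most `r` steps and the `s`-part `M₁`
raises by at least `c ≥ 1` steps yields `FlagAdaptedUpTo m k n M` with `p = L`, drop `r`, weight `a + 1 = c + r`,
whenever `⌊(L − 1 + r(n−1))/(c+r)⌋ ≤ k`. [folklore; FlagCoords `flagAdaptedUpTo_of_flag` is `r = 0, c = 1`] -/
theorem flagAdaptedUpTo_of_chain (F : ℕ → Submodule ℂ (Fin m → ℂ)) (hanti : Antitone F) (hF0 : F 0 = ⊤) {L : ℕ}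
    (hFL : F L = ⊥) (M : Matrix (Fin m) (Fin m) (MvPolynomial (Fin 1) ℂ)) (r c : ℕ) (hc : 1 ≤ c)
    (h0 : ∀ t, ∀ w ∈ F t, (M.map (coeff 0)).mulVec w ∈ F (t - r))
    (h1 : ∀ t, ∀ w ∈ F t, (M.map (coeff (Finsupp.single 0 1))).mulVec w ∈ F (t + c))
    (h2 : ∀ d : Fin 1 →₀ ℕ, 2 ≤ d 0 → ∀ i j, coeff d (M i j) = 0) {n k : ℕ}
    (hk : (L - 1 + r * (n - 1)) / (c + r) ≤ k) :
    FlagAdaptedUpTo m k n M := by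
  classical
  obtain ⟨B, lvl, hli, hsp, hmemF, hlvlL, hspan⟩ := exists_adapted_set F hanti hF0 L hFL
  have hli' : LinearIndependent ℂ (fun u : B => (u : Fin m → ℂ)) := hli.linearIndependent
  have hsp' : ⊤ ≤ Submodule.span ℂ (Set.range fun u : B => (u : Fin m → ℂ)) := by
    rw [Subtype.range_coe, hsp]
  let bB : Module.Basis B ℂ (Fin m → ℂ) := Module.Basis.mk hli' hsp'
  haveI : Fintype B := hli'.setFinite.fintype
  have hcard : Fintype.card B = m := by
    have h := Module.finrank_eq_card_basis bB
    rw [Module.finrank_fin_fun] at h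
    exact h.symm
  let e : B ≃ Fin m := Fintype.equivFinOfCardEq hcard
  let b : Module.Basis (Fin m) ℂ (Fin m → ℂ) := bB.reindex e
  have hb : ∀ i, b i = ((e.symm i : B) : Fin m → ℂ) := fun i => by
    show (bB.reindex e) i = _
    rw [Module.Basis.reindex_apply, Module.Basis.mk_apply]
  have hbmem : ∀ i, b i ∈ B := fun i => by rw [hb]; exact (e.symm i).2
  -- coordinates supported on high levels
  have key : ∀ (t : ℕ) (w : Fin m → ℂ), w ∈ F t → ∀ i, b.repr w i ≠ 0 → t ≤ lvl (b i) := by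
    intro t w hw i hi
    have hw' : w ∈ Submodule.span ℂ (b '' {i | t ≤ lvl (b i)}) := by
      refine Submodule.span_mono ?_ (hspan t hw)
      rintro u ⟨huB, hut⟩
      refine ⟨e ⟨u, huB⟩, ?_, ?_⟩
      · show t ≤ lvl (b (e ⟨u, huB⟩))
        rw [hb, Equiv.symm_apply_apply]
        exact hut
      · rw [hb, Equiv.symm_apply_apply]
    have hsub := b.repr_support_subset_of_mem_span _ hw'
    exact hsub (Finsupp.mem_support_iff.2 hi)
  -- the change of basis
  let Q : Matrix (Fin m) (Fin m) ℂ := LinearMap.toMatrix' (b.equivFun : (Fin m → ℂ) →ₗ[ℂ] (Fin m → ℂ))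
  let P : Matrix (Fin m) (Fin m) ℂ := LinearMap.toMatrix' (b.equivFun.symm : (Fin m → ℂ) →ₗ[ℂ] (Fin m → ℂ))
  let g : (Matrix (Fin m) (Fin m) ℂ)ˣ :=
    ⟨Q, P, toMatrix'_equivFun_mul_symm b, toMatrix'_symm_mul_equivFun b⟩
  have hcr : 1 ≤ c + r := by omega
  unfold FlagAdaptedUpTo flagDeg FlagAdapted
  refine ⟨g, fun i => lvl (b i), L, r, c + r - 1, ?_, ?_, ?_⟩
  · -- levels are `< L`: a basis vector of level `L` would lie in `F L = ⊥`
    intro i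
    rcases (hlvlL (b i) (hbmem i)).lt_or_eq with hlt | heq
    · exact hlt
    · exfalso
      have hmem := hmemF (b i) (hbmem i)
      rw [heq, hFL, Submodule.mem_bot] at hmem
      exact b.ne_zero i hmem
  · rw [Nat.sub_add_cancel hcr]; exact hk
  · intro i j d hd
    show (c + r - 1 + 1) * d 0 + lvl (b j) ≤ lvl (b i) + r
    rw [Nat.sub_add_cancel hcr]
    have hg : ((g : (Matrix (Fin m) (Fin m) ℂ)ˣ) : Matrix (Fin m) (Fin m) ℂ) = Q := rfl
    have hg' : ((g⁻¹ : (Matrix (Fin m) (Fin m) ℂ)ˣ) : Matrix (Fin m) (Fin m) ℂ) = P := rfl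
    rw [hg, hg', coeff_conj_apply] at hd
    have hdd : d = Finsupp.single 0 (d 0) := by
      refine Finsupp.ext fun t => ?_
      have ht : t = 0 := Subsingleton.elim t 0
      subst ht
      rw [Finsupp.single_eq_same]
    rcases Nat.lt_or_ge (d 0) 2 with hlt | hge
    · rcases (show d 0 = 0 ∨ d 0 = 1 by omega) with h | h
      · -- constant part: drops by at most `r`
        have hd0 : d = 0 := by rw [hdd, h, Finsupp.single_zero]
        rw [hd0, conj_entry_eq_repr] at hd
        have hw : (M.map (coeff 0)).mulVec (b j) ∈ F (lvl (b j) - r) := h0 _ _ (hmemF _ (hbmem j))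
        have hle := key _ _ hw i hd
        rw [h]
        omega
      · -- `s`-part: climbs by at least `c`
        have hd1 : d = Finsupp.single 0 1 := by rw [hdd, h]
        rw [hd1, conj_entry_eq_repr] at hd
        have hw : (M.map (coeff (Finsupp.single 0 1))).mulVec (b j) ∈ F (lvl (b j) + c) :=
          h1 _ _ (hmemF _ (hbmem j))
        have hle := key _ _ hw i hd
        rw [h]
        omega
    · -- no higher powers of `s`
      exfalso
      apply hd
      have hz : M.map (coeff d) = 0 := by
        ext k l
        rw [Matrix.map_apply, Matrix.zero_apply]
        exact h2 d hge k l
      rw [hz, Matrix.mul_zero, Matrix.zero_mul, Matrix.zero_apply]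

/-- **Word-tame ⇒ flag certificate** (the converse of p613488, with the CANONICAL flag).  If the pair
`(M₀, M₁) = (coeff_{s⁰} M, coeff_{s¹} M)` is word-tame with budget `k` (and `M` has no `s²`), then `FlagAdaptedUpTo m k n M`:
the certifying chain is `F_t = ⋂ {ker (word w) : Θ + r·#M₀(w) < c·#M₁(w) + t}` (`F_0 = ⊤` because the words outside the
profile vanish, `F_{Θ+1} = ⊥` by the empty word, `M₁ F_t ⊆ F_{t+c}` and `M₀ F_t ⊆ F_{t−r}` by appending a letter).
[this file; folklore] -/
theorem flagAdaptedUpTo_of_wordTame (M : Matrix (Fin m) (Fin m) (MvPolynomial (Fin 1) ℂ))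
    (h2 : ∀ d : Fin 1 →₀ ℕ, 2 ≤ d 0 → ∀ i j, coeff d (M i j) = 0) {n k : ℕ}
    (hW : WordTame n k (M.map (coeff 0)) (M.map (coeff (Finsupp.single 0 1)))) :
    FlagAdaptedUpTo m k n M := by
  classical
  obtain ⟨r, c, Θ, hc, hk, hwords⟩ := hW
  set T₀ : Matrix (Fin m) (Fin m) ℂ := M.map (coeff 0) with hT₀
  set T₁ : Matrix (Fin m) (Fin m) ℂ := M.map (coeff (Finsupp.single 0 1)) with hT₁
  -- words outside the profile vanish
  have hzero : ∀ w : List Bool, Θ + r * w.count false < c * w.count true → word T₀ T₁ w = 0 := by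
    intro w hw
    by_contra hne
    have := hwords w hne
    omega
  -- the canonical sublevel chain of the word valuation
  let S : ℕ → Set (List Bool) := fun t => {w | Θ + r * w.count false < c * w.count true + t}
  let F : ℕ → Submodule ℂ (Fin m → ℂ) :=
    fun t => ⨅ w ∈ S t, LinearMap.ker (Matrix.mulVecLin (word T₀ T₁ w))
  have hmem : ∀ t v, v ∈ F t ↔ ∀ w ∈ S t, (word T₀ T₁ w).mulVec v = 0 := by
    intro t v
    simp only [F, Submodule.mem_iInf, LinearMap.mem_ker, Matrix.mulVecLin_apply]
  have hS : ∀ t w, w ∈ S t ↔ Θ + r * w.count false < c * w.count true + t := fun t w => Iff.rfl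
  have hct : ∀ w : List Bool, (w ++ [true]).count true = w.count true + 1 := fun w => by simp
  have hcf : ∀ w : List Bool, (w ++ [true]).count false = w.count false := fun w => by simp
  have hct' : ∀ w : List Bool, (w ++ [false]).count true = w.count true := fun w => by simp
  have hcf' : ∀ w : List Bool, (w ++ [false]).count false = w.count false + 1 := fun w => by simp
  have hanti : Antitone F := by
    intro t t' htt' v hv
    rw [hmem] at hv ⊢
    intro w hw
    exact hv w (by rw [hS] at hw ⊢; omega)
  have hF0 : F 0 = ⊤ := by
    rw [eq_top_iff]
    intro v _
    rw [hmem]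
    intro w hw
    rw [hS] at hw
    rw [hzero w (by omega), Matrix.zero_mulVec]
  have hFL : F (Θ + 1) = ⊥ := by
    rw [eq_bot_iff]
    intro v hv
    rw [hmem] at hv
    have h := hv [] (by rw [hS]; simp)
    rw [word_nil, Matrix.one_mulVec] at h
    rw [Submodule.mem_bot]
    exact h
  have h1 : ∀ t, ∀ v ∈ F t, T₁.mulVec v ∈ F (t + c) := by
    intro t v hv
    rw [hmem] at hv ⊢
    intro w hw
    have hw' : w ++ [true] ∈ S t := by
      rw [hS] at hw ⊢
      rw [hct, hcf]
      have : c * (w.count true + 1) = c * w.count true + c := by ring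
      omega
    have h := hv _ hw'
    rw [word_append_singleton] at h
    simpa [Matrix.mulVec_mulVec] using h
  have h0 : ∀ t, ∀ v ∈ F t, T₀.mulVec v ∈ F (t - r) := by
    intro t v hv
    rw [hmem] at hv ⊢
    intro w hw
    rw [hS] at hw
    rcases Nat.lt_or_ge t r with htr | htr
    · -- `t < r`: the word itself lies outside the profile
      have ht0 : t - r = 0 := Nat.sub_eq_zero_of_le htr.le
      rw [ht0, add_zero] at hw
      rw [hzero w hw, Matrix.zero_mulVec]
    · have hw' : w ++ [false] ∈ S t := by
        rw [hS, hct', hcf']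
        have : r * (w.count false + 1) = r * w.count false + r := by ring
        omega
      have h := hv _ hw'
      rw [word_append_singleton] at h
      simpa [Matrix.mulVec_mulVec] using h
  exact flagAdaptedUpTo_of_chain F hanti hF0 hFL M r c hc h0 h1 h2 (by rw [Nat.add_sub_cancel]; exact hk)

/-- **Flag certificate ⇒ word-tame** (p613488 `level_bound_word`, read as a profile bound): from an adapted basis with
levels `< p`, drop `r`, weight `a + 1` and budget `≤ k ≤ n − 2` one gets `r ≤ a` and the profile
`(a + 1 − r)·#M₁(w) ≤ (p − 1) + r·#M₀(w)` on every nonzero word. [p613488; this file] -/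
theorem wordTame_of_flagAdaptedUpTo (M : Matrix (Fin m) (Fin m) (MvPolynomial (Fin 1) ℂ)) {n k : ℕ}
    (hkn : k + 2 ≤ n) (h : FlagAdaptedUpTo m k n M) :
    WordTame n k (M.map (coeff 0)) (M.map (coeff (Finsupp.single 0 1))) := by
  classical
  obtain ⟨g, lvl, p, r, a, hl, hk, hA⟩ := h
  unfold flagDeg at hk
  set T₀ : Matrix (Fin m) (Fin m) ℂ := M.map (coeff 0) with hT₀
  set T₁ : Matrix (Fin m) (Fin m) ℂ := M.map (coeff (Finsupp.single 0 1)) with hT₁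
  set G : Matrix (Fin m) (Fin m) ℂ := (g : Matrix (Fin m) (Fin m) ℂ) with hG
  set G' : Matrix (Fin m) (Fin m) ℂ := (↑g⁻¹ : Matrix (Fin m) (Fin m) ℂ) with hG'
  have hGG' : G * G' = 1 := by rw [hG, hG']; exact Units.mul_inv g
  have hG'G : G' * G = 1 := by rw [hG, hG']; exact Units.inv_mul g
  have h0 : ∀ i j, (G * T₀ * G') i j ≠ 0 → lvl j ≤ lvl i + r := by
    intro i j hij
    rw [hT₀, ← coeff_conj_apply] at hij
    have := hA i j 0 hij
    simpa using this
  have h1 : ∀ i j, (G * T₁ * G') i j ≠ 0 → (a + 1) + lvl j ≤ lvl i + r := by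
    intro i j hij
    rw [hT₁, ← coeff_conj_apply] at hij
    have := hA i j (Finsupp.single 0 1) hij
    simpa using this
  -- the drop never exceeds the weight when the budget is `≤ n − 2`
  have hra : r ≤ a := by
    by_contra hlt
    push Not at hlt
    have h3 : n - 1 ≤ (p - 1 + r * (n - 1)) / (a + 1) := by
      rw [Nat.le_div_iff_mul_le (by omega : 0 < a + 1)]
      have : (n - 1) * (a + 1) ≤ r * (n - 1) := by
        rw [Nat.mul_comm]
        exact Nat.mul_le_mul_right _ hlt
      omega
    omega
  refine ⟨r, a + 1 - r, p - 1, by omega, ?_, fun w hw => ?_⟩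
  · rw [Nat.sub_add_cancel (by omega : r ≤ a + 1)]
    exact hk
  · -- a nonzero word: conjugate it and read the levels off with `level_bound_word`
    have hne : (w.map fun b => if b then G * T₁ * G' else G * T₀ * G').prod ≠ 0 := by
      rw [word_conj G G' T₁ T₀ hGG' hG'G w]
      intro hzero
      apply hw
      have hw' : word T₀ T₁ w = G' * (G * (w.map fun b => if b then T₁ else T₀).prod * G') * G := by
        unfold word
        calc (w.map fun b => if b then T₁ else T₀).prod
            = (G' * G) * (w.map fun b => if b then T₁ else T₀).prod * (G' * G) := by
              rw [hG'G, Matrix.one_mul, Matrix.mul_one]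
          _ = G' * (G * (w.map fun b => if b then T₁ else T₀).prod * G') * G := by
              simp only [Matrix.mul_assoc]
      rw [hw', hzero, Matrix.mul_zero, Matrix.zero_mul]
    obtain ⟨i, j, hij⟩ : ∃ i j, (w.map fun b => if b then G * T₁ * G' else G * T₀ * G').prod i j ≠ 0 := by
      by_contra hall
      push Not at hall
      exact hne (Matrix.ext fun i j => by rw [hall i j, Matrix.zero_apply])
    have hb := level_bound_word (G * T₀ * G') (G * T₁ * G') lvl (a + 1) r h0 h1 w i j hij
    have hi := hl i
    have hlen : w.count false + w.count true = w.length := by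
      have := List.count_not_add_count w true
      simpa using this
    have hsplit : r * w.length = r * w.count false + r * w.count true := by
      rw [← hlen, Nat.mul_add]
    rw [hsplit] at hb
    rw [Nat.sub_mul]
    generalize (a + 1) * List.count true w = A at hb ⊢
    generalize r * List.count true w = Rc at hb ⊢
    generalize r * List.count false w = Rf at hb ⊢
    omega

/-- **WORD–FLAG DUALITY.** For `k + 2 ≤ n` and `M = M₀ + s·M₁` with no `s²`:
`FlagAdaptedUpTo m k n M ↔ WordTame n k M₀ M₁`. [this file] -/
theorem flagAdaptedUpTo_iff_wordTame (M : Matrix (Fin m) (Fin m) (MvPolynomial (Fin 1) ℂ))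
    (h2 : ∀ d : Fin 1 →₀ ℕ, 2 ≤ d 0 → ∀ i j, coeff d (M i j) = 0) {n k : ℕ} (hkn : k + 2 ≤ n) :
    FlagAdaptedUpTo m k n M ↔ WordTame n k (M.map (coeff 0)) (M.map (coeff (Finsupp.single 0 1))) :=
  ⟨wordTame_of_flagAdaptedUpTo M hkn, flagAdaptedUpTo_of_wordTame M h2⟩

/-- **The refuter's kill, word form** (`word_eq_zero_of_flagAdapted` of p613488 in dual currency): ONE nonzero word of
length `≤ n − 1` with more than `k` letters `T₁` forbids word-tameness with budget `k`. [p613488; this file] -/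
theorem not_wordTame_of_word {n k : ℕ} (T₀ T₁ : Matrix (Fin m) (Fin m) ℂ) (w : List Bool)
    (hw : word T₀ T₁ w ≠ 0) (he : k < w.count true) (hl : w.length ≤ n - 1) : ¬ WordTame n k T₀ T₁ := by
  rintro ⟨r, c, Θ, hc, hk, hW⟩
  have hb := hW w hw
  have hlen : w.count false + w.count true = w.length := by
    have := List.count_not_add_count w true
    simpa using this
  -- `⌊(Θ + r(n-1))/(c+r)⌋ ≤ k < #T₁` gives `Θ + r(n-1) < (c+r)·#T₁`
  have hlt : Θ + r * (n - 1) < (c + r) * w.count true := by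
    by_contra hge
    push Not at hge
    have : w.count true ≤ (Θ + r * (n - 1)) / (c + r) :=
      (Nat.le_div_iff_mul_le (by omega)).2 (by rw [Nat.mul_comm]; exact hge)
    omega
  have hr : r * w.count false + r * w.count true ≤ r * (n - 1) := by
    rw [← Nat.mul_add, hlen]
    exact Nat.mul_le_mul_left _ hl
  rw [Nat.add_mul] at hlt
  generalize c * List.count true w = Ct at hb hlt
  generalize r * List.count true w = Rt at hlt hr
  generalize r * List.count false w = Rf at hb hr
  generalize r * (n - 1) = Rn at hlt hr
  omega

/-- The one-variable pencil along `x + s·v`: constant part `N(x)`, `s`-part `N_lin(v)`, no `s²` (FineFlag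
`coeff_map_lineSubst`, in this file's vocabulary). [folklore] -/
theorem coeffs_map_lineSubst {n : ℕ} (N : AffMat n m) (hN : IsAffine N) (x v : Fin n × Fin n → ℂ) :
    (N.map (lineSubst x v)).map (coeff 0) = N.map (MvPolynomial.eval x) ∧
    (N.map (lineSubst x v)).map (coeff (Finsupp.single 0 1)) = linPart N v ∧
    (∀ d : Fin 1 →₀ ℕ, 2 ≤ d 0 → ∀ i j, coeff d ((N.map (lineSubst x v)) i j) = 0) :=
  coeff_map_lineSubst N hN x v

/-- **`FlagCheap` in word currency** (affine pencils): `N` is flag-cheap iff some direction space `K` with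
`(k+1)·n < dim K` carries, on every line `x + s·v` (`v ∈ K`), only WORD-TAME pairs `(N(x), N_lin(v))` of budget `k`.
This is the exact atomic content of S3b / R2: no flags, no bases — nonzero-word profiles. [this file] -/
theorem flagCheap_iff_wordTame {n : ℕ} (N : AffMat n m) (hN : IsAffine N) :
    FlagCheap n m N ↔ ∃ (K : Submodule ℂ (Fin n × Fin n → ℂ)) (k : ℕ), (k + 1) * n < Module.finrank ℂ K ∧
      ∀ x v : Fin n × Fin n → ℂ, v ∈ K → WordTame n k (N.map (MvPolynomial.eval x)) (linPart N v) := by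
  unfold FlagCheap
  constructor
  · rintro ⟨K, k, hK, hdim⟩
    have hKn : Module.finrank ℂ K ≤ n * n := by
      have h1 := Submodule.finrank_le K
      rw [Module.finrank_fintype_fun_eq_card, Fintype.card_prod, Fintype.card_fin] at h1
      exact h1
    have hkn : k + 2 ≤ n := by
      have h2 : (k + 1) * n < n * n := lt_of_lt_of_le hdim hKn
      have h3 : k + 1 < n := Nat.lt_of_mul_lt_mul_right h2
      omega
    refine ⟨K, k, hdim, fun x v hv => ?_⟩
    obtain ⟨h0, h1, -⟩ := coeffs_map_lineSubst N hN x v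
    rw [← h0, ← h1]
    exact wordTame_of_flagAdaptedUpTo _ hkn (hK x v hv)
  · rintro ⟨K, k, hdim, hW⟩
    refine ⟨K, k, fun x v hv => ?_, hdim⟩
    obtain ⟨h0, h1, h2⟩ := coeffs_map_lineSubst N hN x v
    refine flagAdaptedUpTo_of_wordTame _ h2 ?_
    rw [h0, h1]
    exact hW x v hv

/-- **ENEMY CRITERION (word form; what a refutation of S3b / R2 on a given pencil must exhibit).**  If inside EVERY
direction space `K` with `(k+1)·n < dim K` some line `x + s·v`, `v ∈ K`, carries a NONZERO word in `{N(x), N_lin(v)}`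
of length `≤ n − 1` with more than `k` letters `N_lin(v)`, then `N` is not flag-cheap. [this file; p613488] -/
theorem not_flagCheap_of_words {n : ℕ} (N : AffMat n m) (hN : IsAffine N)
    (h : ∀ (K : Submodule ℂ (Fin n × Fin n → ℂ)) (k : ℕ), (k + 1) * n < Module.finrank ℂ K →
      ∃ x v : Fin n × Fin n → ℂ, v ∈ K ∧ ∃ w : List Bool,
        word (N.map (MvPolynomial.eval x)) (linPart N v) w ≠ 0 ∧ k < w.count true ∧ w.length ≤ n - 1) :
    ¬ FlagCheap n m N := by
  rw [flagCheap_iff_wordTame N hN]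
  rintro ⟨K, k, hdim, hW⟩
  obtain ⟨x, v, hv, w, hw, he, hl⟩ := h K k hdim
  exact not_wordTame_of_word _ _ w hw he hl (hW x v hv)

/-- **`WordCheap`**: the word-currency twin of `FlagCheap` — a direction space `K` with `(k+1)·n < dim K` on whose lines
every pair `(N(x), N_lin(v))` is word-tame with budget `k`.  Equal to `FlagCheap` for affine `N` (`flagCheap_iff_wordTame`). -/
def WordCheap (n m : ℕ) (N : AffMat n m) : Prop :=
  ∃ (K : Submodule ℂ (Fin n × Fin n → ℂ)) (k : ℕ), (k + 1) * n < Module.finrank ℂ K ∧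
    ∀ x v : Fin n × Fin n → ℂ, v ∈ K → WordTame n k (N.map (MvPolynomial.eval x)) (linPart N v)

theorem flagCheap_iff_wordCheap {n : ℕ} (N : AffMat n m) (hN : IsAffine N) : FlagCheap n m N ↔ WordCheap n m N :=
  flagCheap_iff_wordTame N hN

/-- **S3b in word currency** (`FlagCostLaw` with `FlagCheap` replaced by `WordCheap`). -/
def FlagCostWordLaw : Prop :=
  ∃ C₀ n₀ : ℕ, ∀ n ≥ n₀, ∀ m : ℕ, C₀ * m ^ 2 < n ^ 3 → ∀ N : AffMat n m, IsAffine N → N ^ m = 0 →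
    WordCheap n m N

/-- **R2 in word currency** (`HeavyTopLaw` with `FlagCheap` replaced by `WordCheap`): on heavy-top thin affine nilpotent
pencils some `K` of dimension `> (k+1)·n` carries only word-tame pairs.  This is the statement a prover attacks by
exhibiting profiles `(r, c, Θ)` and a refuter attacks by exhibiting `M₁`-rich nonzero short words (`not_flagCheap_of_words`). -/
def HeavyTopWordLaw : Prop :=
  ∃ C₀ n₀ : ℕ, ∀ n ≥ n₀, ∀ m : ℕ, C₀ * m ^ 2 < n ^ 3 → ∀ N : AffMat n m, IsAffine N → N ^ m = 0 →
    (∀ K : Submodule ℂ (Fin n × Fin n → ℂ), RadOrth n m N K →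
      Module.finrank ℂ K ≤ 16 * m * Nat.sqrt n + 16 * n) →
    WordCheap n m N

/-- S3b ⟺ its word form. [this file] -/
theorem flagCostLaw_iff_word : FlagCostLaw ↔ FlagCostWordLaw := by
  constructor
  · rintro ⟨C₀, n₀, h⟩
    exact ⟨C₀, n₀, fun n hn m' hm N hN hnil => (flagCheap_iff_wordCheap N hN).1 (h n hn m' hm N hN hnil)⟩
  · rintro ⟨C₀, n₀, h⟩
    exact ⟨C₀, n₀, fun n hn m' hm N hN hnil => (flagCheap_iff_wordCheap N hN).2 (h n hn m' hm N hN hnil)⟩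

/-- R2 ⟺ its word form. [this file] -/
theorem heavyTopLaw_iff_word : HeavyTopLaw ↔ HeavyTopWordLaw := by
  constructor
  · rintro ⟨C₀, n₀, h⟩
    exact ⟨C₀, n₀, fun n hn m' hm N hN hnil hK => (flagCheap_iff_wordCheap N hN).1 (h n hn m' hm N hN hnil hK)⟩
  · rintro ⟨C₀, n₀, h⟩
    exact ⟨C₀, n₀, fun n hn m' hm N hN hnil hK => (flagCheap_iff_wordCheap N hN).2 (h n hn m' hm N hN hnil hK)⟩

/-- **The crux from R2 in word currency** (R1 is a theorem, p623799): `HeavyTopWordLaw → DualUnipotentThreeHalves`. -/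
theorem dualUnipotentThreeHalves_of_heavyTopWord (h : HeavyTopWordLaw) : DualUnipotentThreeHalves :=
  dualUnipotentThreeHalves_of_heavyTop (heavyTopLaw_iff_word.2 h)

end WordFlagDuality

/-! ## §8 THE FINITE INSTANCES OF R2 (director-valiant R227, 2026-08-28) — the decided band, the first open format, the first false format

`HeavyTopInst n m` is the body of R2 `HeavyTopLaw` at ONE format `(n, m)` (`heavyTopLaw_iff_inst`).  Ledger, kernel-checked below:

* THE QUADRATIC BAND IS TRUE (`heavyTopInst_of_choose_two_add_lt`): whenever `m(m−1)/2 + n < n²`, EVERY affine nilpotent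
  `m × m` pencil over `ℂ^{n×n}` is flag-cheap, heavy-top or not — budget `k = 0` on the kernel of the top map.  (The tops
  `N_lin(v)` are nilpotent, `linPart_pow_eq_zero`: `s·N(s⁻¹v) = s·N(0) + N_lin(v)` is nilpotent for `s ≠ 0`, let `s → 0`; so they
  span a nilpotent linear space, of dimension `≤ m(m−1)/2` by Gerstenhaber — the tree's
  `Literature.LinearAlgebra.Matrix.GerstenhaberNilpotentSubspace.finrank_le_choose_two`; the kernel has dimension `> n` and the
  pairs `(N(x), 0)` are word-tame with budget `0`.)  This contains every format `m ≤ n` (`heavyTopInst_of_le`), hence the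
  hypothesis-side vacuity range `m ≤ n − 8√n − 9` of ✓ p619580 and the first «heavy-specific» formats; all decided TRUE, trivially.
* THE FIRST OPEN FORMAT is the least `(n, m)` with `C₀·m² < n³` outside the band: `(3, 4)` for `C₀ = 1` (`(5, 7)` for `C₀ = 2`,
  `(7, 10)` for `C₀ = 3`; `format_three_four`).  There the heavy-top hypothesis is automatic (`16·4·⌊√3⌋ + 48 ≥ 9`), so
  `HeavyTopInst 3 4` = S3b(3,4): «every affine nilpotent `4 × 4` pencil over `ℂ^{3×3}` is flag-cheap».  REDUCTION
  (`heavyTopInst_three_four_of_sqZeroInSix`): budget `1` at `n = 3` is implied by «`N_lin(v)² = 0` on `K`»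
  (`wordTame_of_sq_eq_zero`: a square-zero letter kills every word with two adjacent copies, so nonzero words have
  `#Q ≤ #P + 1` — profile `(r, c, Θ) = (1, 1, 1)`), and conversely budget `k` with `k + 2 ≤ n` forces `N_lin(v)^{k+1} = 0`
  (`pow_eq_zero_of_wordTame`, the word form of ✓ p613488 `linPart_pow_eq_zero_of_flagCheap`); with `≤ 5` tops the kernel
  already works, and with `6` tops one needs a `4`-dimensional square-zero subspace of the top space.  So
  `SqZeroInSix → HeavyTopInst 3 4`, where `SqZeroInSix` := «every `6`-dimensional nilpotent subspace of `M₄(ℂ)` contains a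
  `4`-dimensional subspace of square-zero matrices» is GERSTENHABER'S EQUALITY CASE at `m = 4` (such a space is conjugate to
  `𝔫₄ ⊇ span{E₁₃, E₁₄, E₂₃, E₂₄}`) [Gerstenhaber 1958, Thm. 2; de Seguins Pazzis, LAA 438 (2013), Thm. 3] — in print, NOT in the
  tree (the Literature file carries the inequality only).
  So the smallest non-trivial instance is decided TRUE on paper by a published theorem and waits in Lean for ONE Literature
  fact (equality case, `m = 4`); `decide` / `nlinarith` / an explicit witness do not apply to it (a `∀` over
  `ℂ⁹`-parametrised pencils — no finite search space; the content is a classification statement, not an inequality).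
* THE FIRST FALSE FORMAT is `(3, 5)` (admissible for `C₀ = 1`: `25 < 27`): `not_heavyTopInst_three_five`, by the explicit
  strictly upper triangular pencil `NFive` (top space `𝔫₅ ∩ {a₁₅ = 0}`, see the sub-section below).  A tiny-`n` artefact of
  the constants (`n₀ ≥ 4` or `C₀ ≥ 2` discards it; for `16m² ≤ n³` such pencils are cheap by ✓ p615665); R2 is NOT refuted.
  `instanceTable_n3` records the whole `n = 3` column.
R227 OUTCOMES, by format: B-trivial on the band · C with an exact kernel-checked reduction at `(3,4)` · A at `(3,5)` for the
INSTANCE only.  Nothing in this section asserts or refutes R2, S3b, 24318 or 8062; VP ≠ VNP is not moved.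
-/

section Instances

open Summit.ValiantsHypothesis.ValiantsHypothesis.Theorems.DualUnipotentThreeHalvesNegative.RadicalSplit (exists_topMap)
open Literature.LinearAlgebra.Matrix.GerstenhaberNilpotentSubspace (finrank_le_choose_two)

variable {m : ℕ}

/-- **The instance of R2 at format `(n, m)`** (the body of `HeavyTopLaw`). -/
def HeavyTopInst (n m : ℕ) : Prop :=
  ∀ N : AffMat n m, IsAffine N → N ^ m = 0 →
    (∀ K : Submodule ℂ (Fin n × Fin n → ℂ), RadOrth n m N K → Module.finrank ℂ K ≤ 16 * m * Nat.sqrt n + 16 * n) →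
    FlagCheap n m N

/-- R2 is «`HeavyTopInst n m` on every admissible format». [definitional] -/
theorem heavyTopLaw_iff_inst :
    HeavyTopLaw ↔ ∃ C₀ n₀ : ℕ, ∀ n ≥ n₀, ∀ m : ℕ, C₀ * m ^ 2 < n ^ 3 → HeavyTopInst n m :=
  Iff.rfl

/-- The top map as a linear map (✓ p619580 `exists_topMap`, restated with `linPart`). -/
theorem exists_topMap_linPart {n : ℕ} (N : AffMat n m) (hN : IsAffine N) :
    ∃ T : (Fin n × Fin n → ℂ) →ₗ[ℂ] Matrix (Fin m) (Fin m) ℂ, ∀ v, T v = linPart N v :=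
  exists_topMap N hN

/-- Evaluations of a nilpotent polynomial pencil are nilpotent: `N(x)^m = 0`. -/
theorem map_eval_pow_eq_zero {n : ℕ} (N : AffMat n m) (hnil : N ^ m = 0) (x : Fin n × Fin n → ℂ) :
    N.map (MvPolynomial.eval x) ^ m = 0 := by
  have h := Matrix.map_pow N (MvPolynomial.eval x) m
  rw [hnil, Matrix.map_zero _ (map_zero _)] at h
  exact h.symm

/-- **Tops of an affine nilpotent pencil are nilpotent**: `N_lin(v)^m = 0` (`s·N(s⁻¹·v) = s·N(0) + N_lin(v)` is nilpotent for
`s ≠ 0`; the nilpotent matrices are closed; let `s → 0`). [folklore] -/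
theorem linPart_pow_eq_zero {n : ℕ} (N : AffMat n m) (hN : IsAffine N) (hnil : N ^ m = 0) (v : Fin n × Fin n → ℂ) :
    linPart N v ^ m = 0 := by
  obtain ⟨T, hT⟩ := exists_topMap N hN
  set A := N.map (MvPolynomial.eval 0) with hA
  have hlin : ∀ w, linPart N w = T w := fun w => (hT w).symm
  have hpath : ∀ s : ℂ, s ≠ 0 → (s • A + linPart N v) ^ m = 0 := by
    intro s hs
    have h2 : N.map (MvPolynomial.eval (s⁻¹ • v)) = A + T (s⁻¹ • v) := by
      rw [hT]; abel
    have h1 : s • A + linPart N v = s • N.map (MvPolynomial.eval (s⁻¹ • v)) := by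
      rw [h2, map_smul, smul_add, smul_smul, mul_inv_cancel₀ hs, one_smul, hlin v]
    rw [h1, smul_pow, map_eval_pow_eq_zero N hnil, smul_zero]
  have hcont : Continuous fun s : ℂ => (s • A + linPart N v) ^ m :=
    ((continuous_id.smul continuous_const).add continuous_const).pow m
  have heq : (fun s : ℂ => (s • A + linPart N v) ^ m) = fun _ => 0 :=
    Continuous.ext_on (dense_compl_singleton 0) hcont continuous_const fun s hs => hpath s hs
  simpa using congr_fun heq 0

/-- **Gerstenhaber bound for the top space**: `dim N_lin(ℂ^{n×n}) ≤ m(m−1)/2`.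
[Gerstenhaber 1958 / de Seguins Pazzis 2013 Thm. 1, via `Literature…GerstenhaberNilpotentSubspace.finrank_le_choose_two`] -/
theorem finrank_range_top_le_choose_two {n : ℕ} (N : AffMat n m) (hN : IsAffine N) (hnil : N ^ m = 0)
    (T : (Fin n × Fin n → ℂ) →ₗ[ℂ] Matrix (Fin m) (Fin m) ℂ) (hT : ∀ v, T v = linPart N v) :
    Module.finrank ℂ (LinearMap.range T) ≤ m.choose 2 := by
  refine finrank_le_choose_two m (LinearMap.range T) fun A hA => ?_
  obtain ⟨v, rfl⟩ := LinearMap.mem_range.1 hA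
  exact ⟨m, by rw [hT]; exact linPart_pow_eq_zero N hN hnil v⟩

theorem word_cons (T₀ T₁ : Matrix (Fin m) (Fin m) ℂ) (b : Bool) (w : List Bool) :
    word T₀ T₁ (b :: w) = (if b then T₁ else T₀) * word T₀ T₁ w := by
  simp [word]

/-- A word containing the zero letter vanishes. -/
theorem word_zero_right_eq_zero (T₀ : Matrix (Fin m) (Fin m) ℂ) (w : List Bool) (h : true ∈ w) : word T₀ 0 w = 0 := by
  unfold word
  apply List.prod_eq_zero
  rw [List.mem_map]
  exact ⟨true, h, by simp⟩

/-- A pair with zero top is word-tame with budget `0` (profile `(r, c, Θ) = (0, 1, 0)`). -/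
theorem wordTame_zero_right (n : ℕ) (T₀ : Matrix (Fin m) (Fin m) ℂ) : WordTame n 0 T₀ 0 := by
  refine ⟨0, 1, 0, le_rfl, by simp, fun w hw => ?_⟩
  have : w.count true = 0 := by
    rw [List.count_eq_zero]
    intro h
    exact hw (word_zero_right_eq_zero T₀ w h)
  simp [this]

/-- **KERNEL TRIVIALITY.**  If the top space has dimension `< n² − n`, the pencil is flag-cheap: budget `0` on
`K = ker N_lin` (pairs `(N(x), 0)`), `dim K = n² − dim(tops) > n`. [this file] -/
theorem flagCheap_of_finrank_range_lt {n : ℕ} (N : AffMat n m) (hN : IsAffine N)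
    (T : (Fin n × Fin n → ℂ) →ₗ[ℂ] Matrix (Fin m) (Fin m) ℂ) (hT : ∀ v, T v = linPart N v)
    (h : Module.finrank ℂ (LinearMap.range T) + n < n * n) : FlagCheap n m N := by
  rw [flagCheap_iff_wordTame N hN]
  refine ⟨LinearMap.ker T, 0, ?_, fun x v hv => ?_⟩
  · have hrn := LinearMap.finrank_range_add_finrank_ker T
    have hV : Module.finrank ℂ (Fin n × Fin n → ℂ) = n * n := by
      simp [Module.finrank_fintype_fun_eq_card]
    rw [hV] at hrn
    generalize n * n = S at hrn h
    omega
  · rw [LinearMap.mem_ker] at hv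
    rw [← hT v, hv]
    exact wordTame_zero_right n _

/-- **THE QUADRATIC BAND OF R2 / S3b IS TRUE.**  For `m(m−1)/2 + n < n²` every affine nilpotent `m × m` pencil over `ℂ^{n×n}`
is flag-cheap. [this file + Gerstenhaber] -/
theorem flagCheap_of_choose_two_add_lt {n : ℕ} (h : m.choose 2 + n < n * n) (N : AffMat n m) (hN : IsAffine N)
    (hnil : N ^ m = 0) : FlagCheap n m N := by
  obtain ⟨T, hT⟩ := exists_topMap_linPart N hN
  have := finrank_range_top_le_choose_two N hN hnil T hT
  exact flagCheap_of_finrank_range_lt N hN T hT (by generalize n * n = S at h ⊢; omega)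

/-- `HeavyTopInst n m` throughout the quadratic band `m(m−1)/2 + n < n²` — the heavy-top hypothesis unused. -/
theorem heavyTopInst_of_choose_two_add_lt {n m : ℕ} (h : m.choose 2 + n < n * n) : HeavyTopInst n m :=
  fun N hN hnil _ => flagCheap_of_choose_two_add_lt h N hN hnil

/-- In particular R2 is decided TRUE at every format `m ≤ n`, `2 ≤ n` (this contains the vacuity range of ✓ p619580 and the
first heavy-specific formats `(22, 2)`, `(33, 7)`). -/
theorem heavyTopInst_of_le {n m : ℕ} (hmn : m ≤ n) (hn : 2 ≤ n) : HeavyTopInst n m := by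
  refine heavyTopInst_of_choose_two_add_lt ?_
  have h1 : m.choose 2 ≤ n.choose 2 := Nat.choose_le_choose 2 hmn
  have h2 : n.choose 2 < n * n - n := by
    rw [Nat.choose_two_right]
    have hpos : 0 < n * (n - 1) := Nat.mul_pos (by omega) (by omega)
    have h3 : n * (n - 1) / 2 < n * (n - 1) := Nat.div_lt_self hpos (by norm_num)
    have h4 : n * (n - 1) = n * n - n := Nat.mul_sub_one n n
    rw [h4] at h3 ⊢
    exact h3
  have h5 : n ≤ n * n := Nat.le_mul_self n
  generalize n * n = S at h2 h5 ⊢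
  omega

/-- Format bookkeeping: `(3, 4)` is admissible for `C₀ = 1` and is the first format outside the quadratic band
(`(3, m)`, `m ≤ 3`, and `(2, m)`, `m ≤ 2`, are inside or inadmissible); `(5, 7)` resp. `(7, 10)` are the first for `C₀ = 2, 3`. -/
theorem format_three_four :
    1 * 4 ^ 2 < 3 ^ 3 ∧ ¬ (Nat.choose 4 2 + 3 < 3 * 3) ∧ Nat.choose 3 2 + 3 < 3 * 3 ∧ ¬ (1 * 3 ^ 2 < 2 ^ 3) ∧
      (2 * 7 ^ 2 < 5 ^ 3 ∧ ¬ (Nat.choose 7 2 + 5 < 5 * 5) ∧ Nat.choose 6 2 + 5 < 5 * 5 ∧ ¬ (2 * 6 ^ 2 < 4 ^ 3)) ∧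
      (3 * 10 ^ 2 < 7 ^ 3 ∧ ¬ (Nat.choose 10 2 + 7 < 7 * 7) ∧ Nat.choose 9 2 + 7 < 7 * 7 ∧ ¬ (3 * 9 ^ 2 < 6 ^ 3)) := by
  decide

/-- Words in a square-zero letter: a nonzero word has no two adjacent `Q`s, hence `#Q ≤ #P + 1`. -/
theorem count_true_le_of_sq_eq_zero (P Q : Matrix (Fin m) (Fin m) ℂ) (hQ : Q * Q = 0) :
    ∀ w : List Bool, word P Q w ≠ 0 → w.count true ≤ w.count false + 1
  | [], _ => by simp
  | [true], _ => by simp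
  | [false], _ => by simp
  | true :: true :: w, h => by
      exfalso; apply h
      rw [word_cons, word_cons, ← Matrix.mul_assoc]
      simp [hQ]
  | true :: false :: w, h => by
      have h' : word P Q w ≠ 0 := by
        intro hw; apply h; rw [word_cons, word_cons, hw]; simp
      have := count_true_le_of_sq_eq_zero P Q hQ w h'
      simp at this ⊢
      omega
  | false :: b :: w, h => by
      have h' : word P Q (b :: w) ≠ 0 := by
        intro hw; apply h; rw [word_cons, hw]; simp
      have := count_true_le_of_sq_eq_zero P Q hQ (b :: w) h'
      simp [List.count_cons] at this ⊢
      omega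

/-- **Square-zero tops are tame with budget `⌊n/2⌋`** (profile `(r, c, Θ) = (1, 1, 1)`); at `n = 3` this is budget `1`. -/
theorem wordTame_of_sq_eq_zero {n k : ℕ} (hk : n / 2 ≤ k) (P Q : Matrix (Fin m) (Fin m) ℂ) (hQ : Q * Q = 0) :
    WordTame n k P Q := by
  refine ⟨1, 1, 1, le_rfl, by omega, fun w hw => ?_⟩
  have := count_true_le_of_sq_eq_zero P Q hQ w hw
  omega

theorem word_replicate_true (P Q : Matrix (Fin m) (Fin m) ℂ) (j : ℕ) : word P Q (List.replicate j true) = Q ^ j := by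
  simp [word, List.map_replicate, List.prod_replicate]

/-- **Budget `k` forces index `≤ k + 1`** when `k + 2 ≤ n` (word form of ✓ p613488 `linPart_pow_eq_zero_of_flagCheap`): the word
`Q^{k+1}` costs `c(k+1) ≤ Θ`, incompatible with `⌊(Θ + r(n−1))/(c+r)⌋ ≤ k`. -/
theorem pow_eq_zero_of_wordTame {n k : ℕ} (hkn : k + 2 ≤ n) (P Q : Matrix (Fin m) (Fin m) ℂ) (h : WordTame n k P Q) :
    Q ^ (k + 1) = 0 := by
  obtain ⟨r, c, Θ, hc, hbud, hw⟩ := h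
  by_contra hne
  have hword := hw (List.replicate (k + 1) true) (by rw [word_replicate_true]; exact hne)
  simp only [List.count_replicate_self, List.count_replicate] at hword
  have hlt : Θ + r * (n - 1) < (k + 1) * (c + r) :=
    (Nat.div_lt_iff_lt_mul (by omega)).1 (Nat.lt_succ_of_le hbud)
  obtain ⟨n1, hn1⟩ : ∃ n1, n - 1 = n1 := ⟨_, rfl⟩
  have hkn1 : k + 1 ≤ n1 := by omega
  rw [hn1] at hlt
  have hmono : r * (k + 1) ≤ r * n1 := Nat.mul_le_mul_left r hkn1
  simp at hword
  nlinarith [hword, hlt, hmono]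

/-- **Gerstenhaber's equality case at `m = 4`, in the form the first open instance needs**: every `6`-dimensional linear space of
nilpotent `4 × 4` complex matrices contains a `4`-dimensional subspace of square-zero matrices.  TRUE IN PRINT (such a space is
conjugate to `𝔫₄ ⊇ span{E₁₃, E₁₄, E₂₃, E₂₄}`) [Gerstenhaber 1958, Thm. 2; de Seguins Pazzis 2013, Thm. 3]; NOT yet a tree fact. -/
def SqZeroInSix : Prop :=
  ∀ V : Submodule ℂ (Matrix (Fin 4) (Fin 4) ℂ), (∀ A ∈ V, IsNilpotent A) → Module.finrank ℂ V = 6 →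
    ∃ W : Submodule ℂ (Matrix (Fin 4) (Fin 4) ℂ), W ≤ V ∧ 4 ≤ Module.finrank ℂ W ∧ ∀ Q ∈ W, Q * Q = 0

/-- **THE FIRST OPEN INSTANCE, REDUCED** (R227): `SqZeroInSix → HeavyTopInst 3 4`.  With `≤ 5` tops the kernel works
(`5 + 3 < 9`); with `6` tops take `K = N_lin⁻¹(W)` for a `4`-dimensional square-zero `W` inside the top space:
`dim K = 4 + 3 = 7 > (1+1)·3` and every pair `(N(x), N_lin(v))`, `v ∈ K`, is tame with budget `1`. [this file] -/
theorem heavyTopInst_three_four_of_sqZeroInSix (hG : SqZeroInSix) : HeavyTopInst 3 4 := by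
  intro N hN hnil _
  obtain ⟨T, hT⟩ := exists_topMap_linPart N hN
  have hle := finrank_range_top_le_choose_two N hN hnil T hT
  have h46 : (4 : ℕ).choose 2 = 6 := by decide
  by_cases h5 : Module.finrank ℂ (LinearMap.range T) ≤ 5
  · exact flagCheap_of_finrank_range_lt N hN T hT (by omega)
  have h6 : Module.finrank ℂ (LinearMap.range T) = 6 := by omega
  have hnilp : ∀ A ∈ LinearMap.range T, IsNilpotent A := by
    intro A hA
    obtain ⟨v, rfl⟩ := LinearMap.mem_range.1 hA
    exact ⟨4, by rw [hT]; exact linPart_pow_eq_zero N hN hnil v⟩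
  obtain ⟨W, hWV, hW4, hWsq⟩ := hG (LinearMap.range T) hnilp h6
  rw [flagCheap_iff_wordTame N hN]
  refine ⟨W.comap T, 1, ?_, fun x v hv => ?_⟩
  · have hrn := LinearMap.finrank_range_add_finrank_ker T
    have hV : Module.finrank ℂ (Fin 3 × Fin 3 → ℂ) = 9 := by
      simp [Module.finrank_fintype_fun_eq_card]
    have hrn' := LinearMap.finrank_range_add_finrank_ker (T.domRestrict (W.comap T))
    rw [LinearMap.range_domRestrict, Submodule.map_comap_eq_self hWV, LinearMap.ker_domRestrict] at hrn'
    have hkerle : LinearMap.ker T ≤ W.comap T := fun u hu => by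
      rw [LinearMap.mem_ker] at hu
      rw [Submodule.mem_comap, hu]
      exact W.zero_mem
    rw [(Submodule.comapSubtypeEquivOfLe hkerle).finrank_eq] at hrn'
    omega
  · rw [Submodule.mem_comap] at hv
    have hsq : linPart N v * linPart N v = 0 := by rw [← hT v]; exact hWsq _ hv
    exact wordTame_of_sq_eq_zero (by norm_num) _ _ hsq

/-! ### The converse: `HeavyTopInst 3 4` is EXACTLY `SqZeroInSix` -/

/-- The linear pencil `x ↦ Σ_c x_c • B_c` as an affine pencil. -/
def linPencil {n : ℕ} (B : Fin n × Fin n → Matrix (Fin m) (Fin m) ℂ) : AffMat n m :=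
  ∑ c, (MvPolynomial.X c : MvPolynomial (Fin n × Fin n) ℂ) • (B c).map MvPolynomial.C

theorem linPencil_apply {n : ℕ} (B : Fin n × Fin n → Matrix (Fin m) (Fin m) ℂ) (i j : Fin m) :
    linPencil B i j = ∑ c, MvPolynomial.X c * MvPolynomial.C (B c i j) := by
  simp [linPencil, Matrix.sum_apply]

theorem isAffine_linPencil {n : ℕ} (B : Fin n × Fin n → Matrix (Fin m) (Fin m) ℂ) : IsAffine (linPencil B) := by
  intro i j
  rw [linPencil_apply]
  refine MvPolynomial.totalDegree_finsetSum_le fun c _ => ?_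
  refine (MvPolynomial.totalDegree_mul _ _).trans ?_
  simp [MvPolynomial.totalDegree_X]

theorem linPencil_map_eval {n : ℕ} (B : Fin n × Fin n → Matrix (Fin m) (Fin m) ℂ) (x : Fin n × Fin n → ℂ) :
    (linPencil B).map (MvPolynomial.eval x) = ∑ c, x c • B c := by
  ext i j
  simp [linPencil_apply, Matrix.sum_apply]

theorem linPart_linPencil {n : ℕ} (B : Fin n × Fin n → Matrix (Fin m) (Fin m) ℂ) (v : Fin n × Fin n → ℂ) :
    linPart (linPencil B) v = ∑ c, v c • B c := by
  unfold linPart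
  rw [linPencil_map_eval, linPencil_map_eval]
  simp

/-- A nilpotent `m × m` matrix has `A^m = 0` (Cayley–Hamilton with `charpoly = X^m`). [Mathlib] -/
theorem pow_eq_zero_of_isNilpotent_matrix (A : Matrix (Fin m) (Fin m) ℂ) (hA : IsNilpotent A) : A ^ m = 0 := by
  have h1 := Matrix.isNilpotent_charpoly_sub_pow_of_isNilpotent hA
  have h2 : A.charpoly = Polynomial.X ^ m := by
    have := h1.eq_zero
    rw [sub_eq_zero] at this
    simpa using this
  have h3 := Matrix.aeval_self_charpoly A
  rwa [h2, map_pow, Polynomial.aeval_X] at h3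

/-- A linear pencil all of whose values satisfy `(·)^m = 0` is a nilpotent polynomial matrix (polynomial identity over `ℂ`). -/
theorem linPencil_pow_eq_zero {n : ℕ} (B : Fin n × Fin n → Matrix (Fin m) (Fin m) ℂ)
    (hB : ∀ x : Fin n × Fin n → ℂ, (∑ c, x c • B c) ^ m = 0) : linPencil B ^ m = 0 := by
  refine Matrix.ext fun i j => ?_
  apply MvPolynomial.funext
  intro x
  have h := congr_fun (congr_fun (hB x) i) j
  rw [← linPencil_map_eval, ← Matrix.map_pow] at h
  simpa [Matrix.map_apply] using h

/-- **Conversely `HeavyTopInst 3 4 → SqZeroInSix`**: realise a `6`-dimensional nilpotent `V ≤ M₄(ℂ)` as the top space of the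
linear pencil `x ↦ φ(x)` for a linear surjection `φ : ℂ^{3×3} ↠ V`; flag-cheapness gives a `K` with `(k+1)·3 < dim K ≤ 9`, so
`k ≤ 1`; the tops on `K` have index `≤ k+1` (`pow_eq_zero_of_wordTame`); `k = 0` would put `K` (dim `≥ 4`) inside the
`3`-dimensional kernel, so `k = 1`, `dim K ≥ 7`, the tops on `K` are square-zero, and `W = N_lin(K)` has `dim ≥ 7 − 3 = 4`.
So the first open instance of R2 IS Gerstenhaber's equality case at `m = 4`, no less. [this file] -/
theorem sqZeroInSix_of_heavyTopInst_three_four (h : HeavyTopInst 3 4) : SqZeroInSix := by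
  intro V hV hV6
  classical
  let b := Module.finBasisOfFinrankEq ℂ V hV6
  let ι : Fin 6 → Fin 3 × Fin 3 := fun i => finProdFinEquiv.symm (Fin.castLE (by norm_num) i)
  have hι : Function.Injective ι := finProdFinEquiv.symm.injective.comp (Fin.castLE_injective _)
  let φ : (Fin 3 × Fin 3 → ℂ) →ₗ[ℂ] V := b.equivFun.symm.toLinearMap ∘ₗ LinearMap.funLeft ℂ ℂ ι
  have hφ : Function.Surjective φ :=
    b.equivFun.symm.surjective.comp (LinearMap.funLeft_surjective_of_injective ℂ ℂ ι hι)
  let B : Fin 3 × Fin 3 → Matrix (Fin 4) (Fin 4) ℂ := fun c => ((φ fun j => if c = j then 1 else 0 : V) : Matrix (Fin 4) (Fin 4) ℂ)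
  have hBdef : ∀ c, B c = ((φ fun j => if c = j then 1 else 0 : V) : Matrix (Fin 4) (Fin 4) ℂ) := fun c => rfl
  have hsum : ∀ v : Fin 3 × Fin 3 → ℂ, (∑ c, v c • B c) = ((φ v : V) : Matrix (Fin 4) (Fin 4) ℂ) := by
    intro v
    rw [LinearMap.pi_apply_eq_sum_univ φ v]
    simp only [hBdef, Submodule.coe_sum, Submodule.coe_smul]
  set N : AffMat 3 4 := linPencil B with hNdef
  have hN : IsAffine N := isAffine_linPencil B
  have hnil : N ^ 4 = 0 := by
    refine linPencil_pow_eq_zero B fun x => ?_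
    rw [hsum]
    exact pow_eq_zero_of_isNilpotent_matrix _ (hV _ (φ x).2)
  have hV9 : Module.finrank ℂ (Fin 3 × Fin 3 → ℂ) = 9 := by simp [Module.finrank_fintype_fun_eq_card]
  have hH : ∀ K : Submodule ℂ (Fin 3 × Fin 3 → ℂ), RadOrth 3 4 N K →
      Module.finrank ℂ K ≤ 16 * 4 * Nat.sqrt 3 + 16 * 3 := by
    intro K _
    have h1 := Submodule.finrank_le K
    omega
  have hFC := h N hN hnil hH
  rw [flagCheap_iff_wordTame N hN] at hFC
  obtain ⟨K, k, hdim, hW⟩ := hFC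
  have hKle : Module.finrank ℂ K ≤ 9 := by
    have h1 := Submodule.finrank_le K
    omega
  have hk1 : k ≤ 1 := by
    by_contra hk
    have : 3 * 3 ≤ (k + 1) * 3 := Nat.mul_le_mul_right 3 (by omega)
    omega
  obtain ⟨T, hT⟩ := exists_topMap_linPart N hN
  have hTφ : ∀ v, T v = ((φ v : V) : Matrix (Fin 4) (Fin 4) ℂ) := fun v => by
    rw [hT, hNdef, linPart_linPencil]
    exact hsum v
  have hTV : ∀ v, T v ∈ V := fun v => by rw [hTφ]; exact (φ v).2
  have hVle : V ≤ LinearMap.range T := fun A hA => by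
    obtain ⟨u, hu⟩ := hφ ⟨A, hA⟩
    exact LinearMap.mem_range.2 ⟨u, by rw [hTφ, hu]⟩
  have hker : Module.finrank ℂ (LinearMap.ker T) ≤ 3 := by
    have hrn := LinearMap.finrank_range_add_finrank_ker T
    have := Submodule.finrank_mono hVle
    omega
  have hpow : ∀ v ∈ K, T v ^ (k + 1) = 0 := fun v hv => by
    rw [hT]
    exact pow_eq_zero_of_wordTame (by omega) _ _ (hW 0 v hv)
  have hk0 : k ≠ 0 := by
    rintro rfl
    have hKker : K ≤ LinearMap.ker T := fun v hv => by
      rw [LinearMap.mem_ker]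
      simpa using hpow v hv
    have := Submodule.finrank_mono hKker
    omega
  obtain rfl : k = 1 := by omega
  refine ⟨K.map T, fun Q hQ => ?_, ?_, fun Q hQ => ?_⟩
  · obtain ⟨v, -, rfl⟩ := Submodule.mem_map.1 hQ
    exact hTV v
  · have hrn' := LinearMap.finrank_range_add_finrank_ker (T.domRestrict K)
    rw [LinearMap.range_domRestrict, LinearMap.ker_domRestrict] at hrn'
    have hle : Module.finrank ℂ ((LinearMap.ker T).comap K.subtype) ≤ Module.finrank ℂ (LinearMap.ker T) := by
      rw [← Submodule.finrank_map_subtype_eq K ((LinearMap.ker T).comap K.subtype)]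
      exact Submodule.finrank_mono (Submodule.map_comap_le _ _)
    omega
  · obtain ⟨v, hv, rfl⟩ := Submodule.mem_map.1 hQ
    simpa [pow_succ] using hpow v hv

/-- **R227, final form: the first open instance of R2 is Gerstenhaber's equality case at `m = 4`.** -/
theorem heavyTopInst_three_four_iff : HeavyTopInst 3 4 ↔ SqZeroInSix :=
  ⟨sqZeroInSix_of_heavyTopInst_three_four, heavyTopInst_three_four_of_sqZeroInSix⟩

/-! ### The format `(3, 5)` is FALSE: an explicit strictly upper triangular `5 × 5` pencil over `ℂ^{3×3}`

At `n = 3` every budget is `k ≤ 1`, so a flag-cheap pencil needs square-zero tops on a `K` of dimension `≥ 7` (or zero tops on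
dimension `≥ 4`).  The linear pencil `NFive` whose top space is `𝔫₅ ∩ {a₁₅ = 0}` (all `9` coordinates, kernel `0`) has none: the
square of a top has entries `a₁₂a₂₃` at `(1,3)` and `a₃₄a₄₅` at `(3,5)`, so on `K` one coordinate of each pair vanishes identically
(`forall_apply_eq_zero_or`), `K` is then the `7`-dimensional joint kernel of two coordinates, contains `e₁₃ + e₃₅`, and
`(E₁₃ + E₃₅)² = E₁₅ ≠ 0`.  Hence `¬ HeavyTopInst 3 5` (`not_heavyTopInst_three_five`) although `(3, 5)` is admissible for `C₀ = 1`
(`25 < 27`).  THIS DOES NOT TOUCH R2 `HeavyTopLaw` (take `n₀ ≥ 4`, or `C₀ ≥ 2`): it is a tiny-`n` artefact of the constants — for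
`16m² ≤ n³` the same triangular pencils are flag-cheap by ✓ p615665 `flagCheap_of_triangularisable`.  It settles the `n = 3` column of
the instance table: `m ≤ 3` TRUE (band), `m = 4` ⟺ Gerstenhaber's equality case (true in print), `m = 5` FALSE, `m ≥ 6` inadmissible.
-/

/-- Powers of a strictly upper triangular matrix climb: `(B^k)_{ab} = 0` for `b < a + k`. -/
theorem pow_apply_eq_zero_of_strictUpper {R : Type*} [CommRing R] {d : ℕ} (B : Matrix (Fin d) (Fin d) R)
    (hB : ∀ a b : Fin d, (b : ℕ) ≤ a → B a b = 0) :
    ∀ k : ℕ, ∀ a b : Fin d, (b : ℕ) < a + k → (B ^ k) a b = 0 := by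
  intro k
  induction k with
  | zero =>
    intro a b hab
    rw [pow_zero, Matrix.one_apply_ne]
    intro h
    subst h
    omega
  | succ k ih =>
    intro a b hab
    rw [pow_succ, Matrix.mul_apply]
    refine Finset.sum_eq_zero fun c _ => ?_
    by_cases hc : (c : ℕ) < a + k
    · rw [ih a c hc, zero_mul]
    · rw [hB c b (by omega), mul_zero]

/-- A strictly upper triangular `d × d` matrix has `B^d = 0`. -/
theorem pow_eq_zero_of_strictUpper {R : Type*} [CommRing R] {d : ℕ} (B : Matrix (Fin d) (Fin d) R)
    (hB : ∀ a b : Fin d, (b : ℕ) ≤ a → B a b = 0) : B ^ d = 0 := by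
  ext a b
  have hb := b.isLt
  exact pow_apply_eq_zero_of_strictUpper B hB d a b (by omega)

/-- The top space `𝔫₅ ∩ {a₁₅ = 0}` parametrised by `ℂ^{3×3}`. -/
def topFive (v : Fin 3 × Fin 3 → ℂ) : Matrix (Fin 5) (Fin 5) ℂ :=
  !![0, v (0,0), v (0,1), v (0,2), 0;
     0, 0, v (1,0), v (1,1), v (1,2);
     0, 0, 0, v (2,0), v (2,1);
     0, 0, 0, 0, v (2,2);
     0, 0, 0, 0, 0]

/-- The linear `5 × 5` pencil over `ℂ^{3×3}` with `N(x) = topFive x`. -/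
def NFive : AffMat 3 5 :=
  !![0, MvPolynomial.X (0,0), MvPolynomial.X (0,1), MvPolynomial.X (0,2), 0;
     0, 0, MvPolynomial.X (1,0), MvPolynomial.X (1,1), MvPolynomial.X (1,2);
     0, 0, 0, MvPolynomial.X (2,0), MvPolynomial.X (2,1);
     0, 0, 0, 0, MvPolynomial.X (2,2);
     0, 0, 0, 0, 0]

theorem isAffine_NFive : IsAffine NFive := by
  intro i j
  fin_cases i <;> fin_cases j <;> simp [NFive, MvPolynomial.totalDegree_X]

theorem NFive_strictUpper : ∀ a b : Fin 5, (b : ℕ) ≤ a → NFive a b = 0 := by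
  intro a b h
  fin_cases a <;> fin_cases b <;> simp [NFive] at h ⊢

theorem NFive_pow : NFive ^ 5 = 0 :=
  pow_eq_zero_of_strictUpper NFive NFive_strictUpper

theorem NFive_map_eval (x : Fin 3 × Fin 3 → ℂ) : NFive.map (MvPolynomial.eval x) = topFive x := by
  ext i j
  fin_cases i <;> fin_cases j <;> simp [NFive, topFive]

theorem linPart_NFive (v : Fin 3 × Fin 3 → ℂ) : linPart NFive v = topFive v := by
  unfold linPart
  rw [NFive_map_eval, NFive_map_eval]
  ext i j
  fin_cases i <;> fin_cases j <;> simp [topFive]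

/-- On a subspace, a product of two coordinates vanishing identically forces one coordinate to vanish identically. -/
theorem forall_apply_eq_zero_or {ι : Type*} (K : Submodule ℂ (ι → ℂ)) (a b : ι)
    (h : ∀ v ∈ K, v a * v b = 0) : (∀ v ∈ K, v a = 0) ∨ (∀ v ∈ K, v b = 0) := by
  by_contra hc
  push Not at hc
  obtain ⟨⟨u, hu, hua⟩, ⟨w, hw, hwb⟩⟩ := hc
  have hub : u b = 0 := (mul_eq_zero.1 (h u hu)).resolve_left hua
  have hwa : w a = 0 := (mul_eq_zero.1 (h w hw)).resolve_right hwb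
  have huw := h (u + w) (K.add_mem hu hw)
  simp only [Pi.add_apply, hub, hwa, add_zero, zero_add] at huw
  rcases mul_eq_zero.1 huw with h1 | h2
  · exact hua h1
  · exact hwb h2

/-- Two distinct coordinate hyperplanes of `ℂ^{3×3}` meet in dimension `≤ 7`. -/
theorem finrank_ker_inf_ker_le (a b : Fin 3 × Fin 3) (hab : a ≠ b) :
    Module.finrank ℂ ↥(LinearMap.ker (LinearMap.proj a : (Fin 3 × Fin 3 → ℂ) →ₗ[ℂ] ℂ) ⊓
      LinearMap.ker (LinearMap.proj b : (Fin 3 × Fin 3 → ℂ) →ₗ[ℂ] ℂ)) ≤ 7 := by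
  classical
  set Ka := LinearMap.ker (LinearMap.proj a : (Fin 3 × Fin 3 → ℂ) →ₗ[ℂ] ℂ) with hKa
  set Kb := LinearMap.ker (LinearMap.proj b : (Fin 3 × Fin 3 → ℂ) →ₗ[ℂ] ℂ) with hKb
  have hV9 : Module.finrank ℂ (Fin 3 × Fin 3 → ℂ) = 9 := by simp [Module.finrank_fintype_fun_eq_card]
  have h1 : Ka < ⊤ := by
    rw [lt_top_iff_ne_top]
    intro h
    have hmem : (Pi.single a (1 : ℂ) : Fin 3 × Fin 3 → ℂ) ∈ Ka := by rw [h]; trivial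
    rw [hKa, LinearMap.mem_ker, LinearMap.proj_apply] at hmem
    simp at hmem
  have h2 : Ka ⊓ Kb < Ka := by
    refine lt_of_le_of_ne inf_le_left fun h => ?_
    have hmem : (Pi.single b (1 : ℂ) : Fin 3 × Fin 3 → ℂ) ∈ Ka := by
      rw [hKa, LinearMap.mem_ker, LinearMap.proj_apply, Pi.single_eq_of_ne hab]
    rw [← h] at hmem
    have hmem' : (Pi.single b (1 : ℂ) : Fin 3 × Fin 3 → ℂ) ∈ Kb := (Submodule.mem_inf.1 hmem).2
    rw [hKb, LinearMap.mem_ker, LinearMap.proj_apply] at hmem'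
    simp at hmem'
  have h3 := Submodule.finrank_lt_finrank_of_lt h1
  have h4 := Submodule.finrank_lt_finrank_of_lt h2
  rw [finrank_top, hV9] at h3
  omega

/-- The witness direction: `v₀ = e₁₃ + e₃₅` in coordinates, `topFive v₀ = E₁₃ + E₃₅`. -/
def vZero : Fin 3 × Fin 3 → ℂ := fun c => if c = (0,1) then 1 else if c = (2,1) then 1 else 0

theorem topFive_vZero_sq_ne_zero : topFive vZero * topFive vZero ≠ 0 := by
  intro h
  have h04 := congr_fun (congr_fun h 0) 4
  simp [topFive, vZero, Matrix.mul_apply, Fin.sum_univ_five] at h04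

/-- **`NFive` is not flag-cheap at `n = 3`.** [this file] -/
theorem not_flagCheap_NFive : ¬ FlagCheap 3 5 NFive := by
  classical
  rw [flagCheap_iff_wordTame NFive isAffine_NFive]
  rintro ⟨K, k, hdim, hW⟩
  have hV9 : Module.finrank ℂ (Fin 3 × Fin 3 → ℂ) = 9 := by simp [Module.finrank_fintype_fun_eq_card]
  have hKle : Module.finrank ℂ K ≤ 9 := by
    have h1 := Submodule.finrank_le K
    omega
  have hk1 : k ≤ 1 := by
    by_contra hk
    have : 3 * 3 ≤ (k + 1) * 3 := Nat.mul_le_mul_right 3 (by omega)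
    omega
  -- tops on `K` have index ≤ k + 1
  have hpow : ∀ v ∈ K, topFive v ^ (k + 1) = 0 := fun v hv => by
    rw [← linPart_NFive]
    exact pow_eq_zero_of_wordTame (by omega) _ _ (hW 0 v hv)
  rcases Nat.le_one_iff_eq_zero_or_eq_one.1 hk1 with rfl | rfl
  · -- budget 0: tops vanish on K, so K = ⊥
    have hK : K = ⊥ := by
      rw [Submodule.eq_bot_iff]
      intro v hv
      have h0 : topFive v = 0 := by simpa using hpow v hv
      funext c
      obtain ⟨i, j⟩ := c
      fin_cases i <;> fin_cases j
      · simpa [topFive] using congr_fun (congr_fun h0 0) 1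
      · simpa [topFive] using congr_fun (congr_fun h0 0) 2
      · simpa [topFive] using congr_fun (congr_fun h0 0) 3
      · simpa [topFive] using congr_fun (congr_fun h0 1) 2
      · simpa [topFive] using congr_fun (congr_fun h0 1) 3
      · simpa [topFive] using congr_fun (congr_fun h0 1) 4
      · simpa [topFive] using congr_fun (congr_fun h0 2) 3
      · simpa [topFive] using congr_fun (congr_fun h0 2) 4
      · simpa [topFive] using congr_fun (congr_fun h0 3) 4
    rw [hK, finrank_bot] at hdim
    omega
  · -- budget 1: square-zero tops on K with dim K ≥ 7
    have hsq : ∀ v ∈ K, topFive v * topFive v = 0 := fun v hv => by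
      simpa [pow_succ] using hpow v hv
    have e02 : ∀ v ∈ K, v (0,0) * v (1,0) = 0 := fun v hv => by
      simpa [topFive, Matrix.mul_apply, Fin.sum_univ_five] using congr_fun (congr_fun (hsq v hv) 0) 2
    have e24 : ∀ v ∈ K, v (2,0) * v (2,2) = 0 := fun v hv => by
      simpa [topFive, Matrix.mul_apply, Fin.sum_univ_five] using congr_fun (congr_fun (hsq v hv) 2) 4
    -- the uniform finish: two vanishing coordinates `a ≠ b` off the support of `vZero` put `vZero` in `K`
    have key : ∀ a b : Fin 3 × Fin 3, a ≠ b → vZero a = 0 → vZero b = 0 →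
        (∀ v ∈ K, v a = 0) → (∀ v ∈ K, v b = 0) → False := by
      intro a b hab ha0 hb0 hKa hKb
      have hKL : K ≤ LinearMap.ker (LinearMap.proj a : (Fin 3 × Fin 3 → ℂ) →ₗ[ℂ] ℂ) ⊓
          LinearMap.ker (LinearMap.proj b : (Fin 3 × Fin 3 → ℂ) →ₗ[ℂ] ℂ) := fun v hv => by
        rw [Submodule.mem_inf, LinearMap.mem_ker, LinearMap.mem_ker, LinearMap.proj_apply, LinearMap.proj_apply]
        exact ⟨hKa v hv, hKb v hv⟩
      have hKeq := Submodule.eq_of_le_of_finrank_le hKL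
        (by have := finrank_ker_inf_ker_le a b hab; omega)
      have hv0 : vZero ∈ K := by
        rw [hKeq, Submodule.mem_inf, LinearMap.mem_ker, LinearMap.mem_ker, LinearMap.proj_apply, LinearMap.proj_apply]
        exact ⟨ha0, hb0⟩
      exact topFive_vZero_sq_ne_zero (hsq vZero hv0)
    rcases forall_apply_eq_zero_or K (0,0) (1,0) e02 with hA | hA <;>
      rcases forall_apply_eq_zero_or K (2,0) (2,2) e24 with hB | hB
    · exact key (0,0) (2,0) (by decide) (by simp [vZero]) (by simp [vZero]) hA hB
    · exact key (0,0) (2,2) (by decide) (by simp [vZero]) (by simp [vZero]) hA hB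
    · exact key (1,0) (2,0) (by decide) (by simp [vZero]) (by simp [vZero]) hA hB
    · exact key (1,0) (2,2) (by decide) (by simp [vZero]) (by simp [vZero]) hA hB

/-- **The format `(3, 5)` of R2 is FALSE** (admissible for `C₀ = 1`: `25 < 27`; the heavy-top hypothesis is automatic at `n = 3`).
NOT a refutation of `HeavyTopLaw` (which may take `n₀ ≥ 4` or `C₀ ≥ 2`); a kernel-checked data point: `C₀ = 1 ∧ n₀ ≤ 3` is not an
admissible parameter choice for R2. [this file] -/
theorem not_heavyTopInst_three_five : ¬ HeavyTopInst 3 5 := by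
  intro h
  have hV9 : Module.finrank ℂ (Fin 3 × Fin 3 → ℂ) = 9 := by simp [Module.finrank_fintype_fun_eq_card]
  refine not_flagCheap_NFive (h NFive isAffine_NFive NFive_pow fun K _ => ?_)
  have h1 := Submodule.finrank_le K
  omega

theorem format_three_five : 1 * 5 ^ 2 < 3 ^ 3 ∧ ¬ (1 * 6 ^ 2 < 3 ^ 3) := by decide

/-- **The `n = 3` column of R2's instance table, as far as the kernel knows it**: `m ≤ 3` true, `m = 4` ⟺ `SqZeroInSix`
(Gerstenhaber's equality case, true in print), `m = 5` false, `m ≥ 6` inadmissible for `C₀ = 1`. -/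
theorem instanceTable_n3 :
    (∀ m ≤ 3, HeavyTopInst 3 m) ∧ (HeavyTopInst 3 4 ↔ SqZeroInSix) ∧ ¬ HeavyTopInst 3 5 ∧ ∀ m ≥ 6, ¬ (1 * m ^ 2 < 3 ^ 3) :=
  ⟨fun m hm => heavyTopInst_of_le hm (by norm_num), heavyTopInst_three_four_iff, not_heavyTopInst_three_five,
    fun m hm h => by nlinarith⟩

end Instances

/-! ## §8b THE FORMAT `(3, 4)` SETTLED BY NAME (val-port-1 g2 wiring, 2026-08-28): Gerstenhaber's equality case landed

Since §8 was written, the one missing input landed in the tree: val-lit-p11 g5 typed [dSP13] Thm 1 (equality half) as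
`Literature.LinearAlgebra.Matrix.GerstenhaberNilpotentSubspace.deSeguinsPazzis2013_equality` with the `4 × 4` corollary
`exists_sqZero_of_equality_four` (✓ p633708), val-lit-p9 g4 PROVED it (`deSeguinsPazzis2013_equality_holds`, ✓ p636258, every
field, every `n`), and §6–§8 of this file were re-landed under `Theorems/` by val-port-1 g2 (✓ p629233 `…NilpotentPencilCore`,
✓ p633199 `…WordDefs` — this file's vocabulary VERBATIM, hence definitionally equal —, ✓ p633481 `…WordFlagDuality`,
✓ p633977 `…WordFlagPencil`, ✓ p635168 `…HeavyTopBand`, ✓ p635270 `…/DualUnipotentThreeHalves/Negative/HeavyTopInstThreeFive`,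
✓ p635572/p635897/p636632 `…HeavyTopThreeFour`).  The aliases below record the settled cell BY NAME (δ-unfolding only):
the `n = 3` column of R2's instance table is COMPLETE — `m ≤ 4` TRUE, `m = 5` FALSE, `m ≥ 6` inadmissible for `C₀ = 1`.
HONEST LABEL: one instance of the LAW; `stub_heavyTopLaw` (R2) is untouched and remains this file's only `sorry`. -/

/-- ★ `HeavyTopInst 3 4` — the first format outside the quadratic band is TRUE (Theorems, ✓ p636632, by name). -/
theorem heavyTopInst_three_four : HeavyTopInst 3 4 :=
  Theorems.GrenetZeon.RadicalSplit.heavyTopInst_three_four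

/-- `SqZeroInSix` holds (Gerstenhaber's equality case at `4 × 4`; Theorems, ✓ p636632, by name). -/
theorem sqZeroInSix : SqZeroInSix :=
  Theorems.GrenetZeon.RadicalSplit.sqZeroInSix

/-- The `n = 3` column of R2's instance table, COMPLETE (Theorems, ✓ p636632, by name). -/
theorem instanceTable_n3_complete :
    (∀ m ≤ 4, HeavyTopInst 3 m) ∧ ¬ HeavyTopInst 3 5 ∧ ∀ m ≥ 6, ¬ (1 * m ^ 2 < 3 ^ 3) :=
  Theorems.GrenetZeon.RadicalSplit.instanceTable_n3_complete

end Summit.ValiantsHypothesis.ValiantsHypothesis.Cruxes.DualUnipotentThreeHalves.RadicalSplit
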